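import Mathlib
import Literature.NumberTheory.Sieve.VinogradovExpSumTools
import Literature.NumberTheory.Sieve.MoebiusWalshCircuitsProofs
import HarnessLib

/-!
# Kátai's argument: Fourier–Walsh coefficients versus exponential sums at sparse dyadic rationals (Green 2012, Proposition 2 and Lemma 1), proved

Topic `Literature/NumberTheory/LFunctions`. Everything in this file is PROVED (no named facts).
It supplies the two elementary, arithmetic-free steps of the proof of Green's bound on the
Fourier–Walsh coefficients of the Möbius function — B. Green, *On (not) computing the Möbius
function using bounded depth circuits*, Combin. Probab. Comput. 21 (2012) 942–951
(arXiv:1103.4991), §3 and Lemma 1 of §4 — in a form that serves BOTH named facts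
`Literature.NumberTheory.LFunctions.green_moebius_fourierWalsh` (Proposition 1 for `μ`) and
`Literature.NumberTheory.LFunctions.green_liouville_fourierWalsh` (Proposition 1 for `λ`) of
`MoebiusWalshCircuits.lean`, and any other `±1`-bounded `f` (Bourgain's Möbius–Walsh theorem uses
the same reduction):

* `Katai.exists_sparseDyadic_of_large_walsh` — **Green's Proposition 2** (an argument of Kátai,
  Acta Math. Hungar. 47 (1986), and Harman–Kátai, Acta Arith. 133 (2008)): if `|f| ≤ 1` on
  `{0, …, 2ⁿ - 1}` and the Fourier–Walsh sum `∑_{x<2ⁿ} f(x) ∏_{j∈S} (-1)^{x_j}` has size `≥ δ2ⁿ`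
  (`S ⊆ {0,…,n-1}`, `|S| = k ≥ 1`, `δ > 0`, `x_j` the binary digit of weight `2^j`), then for some
  integers `|r_j| ≤ R := ⌈64k²/δ²⌉` the exponential sum at the *sparse dyadic rational*
  `θ = ∑_{j∈S} r_j/2^{j+1}` is large: `|∑_{x<2ⁿ} f(x)e(θx)| ≥ δ2ⁿ/(2(2R+1)^k)`;
  `Katai.exists_sparseDyadic_of_large_walshSum` — the same in the tree's vocabulary
  (`Literature.NumberTheory.LFunctions.walshSum g S`, `S : Finset (Fin n)`, `g : ℕ → ℤ`, `|g| ≤ 1`).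
* `Katai.exists_eq_two_pow_of_near_sparseDyadic` — **Green's Lemma 1** (the observation of Harman
  and Kátai): if `θ = ∑_{i∈S} r_i/2^{i}` with `S ⊆ {0,…,n}`, `|S| = k`, `|r_i| ≤ Q`, and
  `|θ - a/q| ≤ Q/2ⁿ` with `q ≤ Q`, `(a, q) = 1`, `2^{n/2k} > 4Q²`, then `q` is a power of two.

What is NOT here: the arithmetic inputs of Green's Proposition 3 (his Theorem 3 = the tree's named
fact `Literature.NumberTheory.LFunctions.green_moebius_character_twoPower`, its Corollaries 1–2,
and the minor-arc estimate Proposition 4 for `∑ μ(x)e(θx)`), hence no discharge of Proposition 1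
itself; this file is the `f`-generic half of that proof.

## The printed argument and its rendering (Green 2012, §3)

Green writes `f̂(S) = 𝔼_x f(x) ∏_{i∈S} ψ(x/2^i)` with the square wave `ψ = 1_{[0,1/2)} - 1_{[1/2,1)}`
on `ℝ/ℤ`, replaces each `ψ` by a smoothing `ψ̃ = (φ ∗ χ ∗ χ)`-truncated with
`𝔼_x|ψ(x/2^i) - ψ̃(x/2^i)| ≤ ε = δ/2k` and `ψ̃(t) = ∑_{|r| ≤ 100ε⁻³} a_r e(rt)`, `|a_r| ≤ 1`, then
expands the product and pigeonholes. We follow exactly this architecture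
(`Katai.norm_sum_mul_prod_sub_le` = "replacing each copy of `ψ` by `ψ̃` in turn",
`Katai.sum_mul_prod_trigPoly_eq` = "develop each `ψ̃` in its Fourier series",
`Katai.exists_norm_ge_of_sum` = the pigeonholing, assembled in
`Katai.exists_pi_of_large_correlation`), but smooth DISCRETELY and per level: the digit sign of
weight `2^j` is the square wave `g` of period `q = 2^{j+1}` on `ℤ` (`Katai.sqWave`,
`Katai.sqWave_two_pow_eq`); for long periods `q ≥ 2(R+1)` it is replaced by its Fejér mean
`P(x) = (q(R+1))⁻¹ ∑_{i<q} |D_R(i/q)|² g(x+i)` (`Katai.fejerApprox`; `D_R` the Dirichlet kernel),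
which is bounded by `1` (`Katai.norm_fejerApprox_le_one`, from the mass identity
`∑_{i<q} |D_R(i/q)|² = q(R+1)`, `Katai.sum_fejerWeight`, i.e. orthogonality), is a trigonometric
polynomial `(R+1)⁻¹ ∑_{0≤r,s≤R} ĝ(s-r) e((s-r)x/q)` with `|ĝ| ≤ 1` (`Katai.fejerApprox_eq_sum`), and
satisfies `∑_{x<q} |g(x) - P(x)| ≤ 4q/√(R+1)` (`Katai.sum_norm_sqWave_sub_fejerApprox_le`: a shift
by `w` changes `g` at `≤ 2|w|`-ish residues, `Katai.flipSum_natCast_le`, and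
`|D_R(w/q)|² ≤ min((R+1)², q²/4w²)`, summed with the harmonic bound `H_n ≤ 1 + log n`); for short
periods `q < 2(R+1)` exact Fourier inversion `g(x) = ∑_{-q/2<d≤q/2} ĝ(d)e(dx/q)` is used instead
(`Katai.sqWave_eq_sum_sqCoeff`). With `R + 1 ≥ 64k²/δ²` the total `L¹` error is `≤ δ2ⁿ/2`.
Consequently the constants differ from the printed ones (`|r_i| ≤ (10k/δ)³`,
`|f̂(θ)| ≥ (δ/10k)^{4k}`): here `|r_j| ≤ ⌈64k²/δ²⌉` and `|∑ f(x)e(θx)| ≥ δ2ⁿ/(2(2R+1)^k)`; any such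
polynomial dependence is what Green's §§3–4 consume. Digits: the tree's digit `j` of weight `2^j`
(`Nat.testBit`, little-endian `bitsToNat`) is Green's digit `i = j + 1` (`x = x₁ + 2x₂ + ⋯`), so
`θ = ∑ r_j/2^{j+1}` is his `∑ r_i/2^{i}`.

Lemma 1 is proved as printed except that the large gap `i_{j+1} - i_j ≥ n/2k` in the exponents is
produced by counting (`Katai.exists_gap`: each exponent forbids fewer than `n/2k` positions) rather
than by sorting the exponents; the conclusion `a/q = a'/2^{i_j}` with `(a,q) = 1` gives `q ∣ 2^{i_j}`.

## References

* B. Green, *On (not) computing the Möbius function using bounded depth circuits*, Combin. Probab.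
  Comput. 21 (2012) 942–951, §3 (Proposition 2), §4 (Lemma 1). [Green2012]
* I. Kátai, *Distribution of digits of primes in q-ary canonical form*, Acta Math. Hungar. 47
  (1986) 341–359; G. Harman, I. Kátai, *Primes with preassigned digits II*, Acta Arith. 133 (2008)
  171–184 (the original arguments, as cited by Green).
-/

noncomputable section

open Finset Real
open scoped FourierTransform

namespace Literature.NumberTheory.LFunctions

namespace Katai

open Literature.NumberTheory.Sieve.Vinogradov (distInt distInt_nonneg norm_fourierChar
  norm_fourierChar_sub_one two_mul_distInt_le_abs_sin)

/-! ### Sums over a period and orthogonality -/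

/-- A sum of a `q`-periodic function over `q` consecutive integers does not depend on where the
block starts. [folklore] -/
theorem sum_range_add_eq_of_periodic {M : Type*} [AddCommGroup M] (h : ℤ → M) (q : ℕ)
    (hper : ∀ y, h (y + q) = h y) (a : ℤ) :
    ∑ i ∈ range q, h (a + i) = ∑ i ∈ range q, h i := by
  induction a using Int.induction_on with
  | zero => simp
  | succ a ih =>
      rw [← ih]
      have h1 : ∑ i ∈ range (q + 1), h ((a : ℤ) + i) =
          (∑ i ∈ range q, h ((a : ℤ) + i)) + h (a + q) := Finset.sum_range_succ _ _
      have h2 : ∑ i ∈ range (q + 1), h ((a : ℤ) + i) =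
          (∑ i ∈ range q, h ((a : ℤ) + 1 + i)) + h a := by
        rw [Finset.sum_range_succ']
        congr 1
        refine Finset.sum_congr rfl fun i _ => ?_
        congr 1; push_cast; ring
      have h3 : h ((a : ℤ) + q) = h a := hper a
      have := h1.symm.trans h2
      rw [h3] at this
      exact (add_right_cancel this).symm
  | pred a ih =>
      rw [← ih]
      have h1 : ∑ i ∈ range (q + 1), h (-(a : ℤ) - 1 + i) =
          (∑ i ∈ range q, h (-(a : ℤ) - 1 + i)) + h (-(a : ℤ) - 1 + q) := Finset.sum_range_succ _ _
      have h2 : ∑ i ∈ range (q + 1), h (-(a : ℤ) - 1 + i) =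
          (∑ i ∈ range q, h (-(a : ℤ) + i)) + h (-(a : ℤ) - 1) := by
        rw [Finset.sum_range_succ']
        congr 1
        · refine Finset.sum_congr rfl fun i _ => ?_
          congr 1; push_cast; ring
        · simp
      have h3 : h (-(a : ℤ) - 1 + q) = h (-(a : ℤ) - 1) := hper (-(a : ℤ) - 1)
      have := h1.symm.trans h2
      rw [h3] at this
      exact add_right_cancel this

/-- A sum of a `q`-periodic function over `q · m` consecutive naturals is `m` times the sum over
one period. [folklore] -/
theorem sum_range_mul_eq_of_periodic {M : Type*} [AddCommGroup M] (h : ℤ → M) (q : ℕ)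
    (hper : ∀ y, h (y + q) = h y) (m : ℕ) :
    ∑ x ∈ range (q * m), h x = m • ∑ i ∈ range q, h i := by
  induction m with
  | zero => simp
  | succ m ih =>
      rw [Nat.mul_succ, Finset.sum_range_add, ih, succ_nsmul]
      congr 1
      have := sum_range_add_eq_of_periodic h q hper (q * m : ℕ)
      rw [← this]
      refine Finset.sum_congr rfl fun i _ => ?_
      push_cast; ring_nf

/-- `e(t) = 1` exactly when `t` is an integer. [folklore] -/
theorem fourierChar_eq_one_iff (t : ℝ) : (𝐞 t : ℂ) = 1 ↔ ∃ m : ℤ, t = m := by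
  rw [Real.fourierChar_apply, Complex.exp_eq_one_iff]
  constructor
  · rintro ⟨m, hm⟩
    refine ⟨m, ?_⟩
    have h2 : (2 * π * Complex.I) ≠ 0 := by
      simp [Real.pi_ne_zero, Complex.I_ne_zero]
    have : (t : ℂ) = m := by
      have hm' : (t : ℂ) * (2 * π * Complex.I) = m * (2 * π * Complex.I) := by
        rw [← hm]; push_cast; ring
      exact mul_right_cancel₀ h2 hm'
    exact_mod_cast this
  · rintro ⟨m, rfl⟩
    exact ⟨m, by push_cast; ring⟩

/-- **Orthogonality of the additive characters modulo `q`** over any block of `q` consecutive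
integers: `∑_{i<q} e((a+i)t/q) = q·[q ∣ t]`. [folklore] -/
theorem sum_range_fourierChar_div (q : ℕ) (hq : 0 < q) (a t : ℤ) :
    ∑ i ∈ range q, (𝐞 (((a + i : ℤ) : ℝ) * t / q) : ℂ) = if (q : ℤ) ∣ t then (q : ℂ) else 0 := by
  split_ifs with hdvd
  · obtain ⟨c, hc⟩ := hdvd
    have : ∀ i ∈ range q, (𝐞 (((a + i : ℤ) : ℝ) * t / q) : ℂ) = 1 := by
      intro i _
      rw [fourierChar_eq_one_iff]
      refine ⟨(a + i) * c, ?_⟩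
      rw [hc]; push_cast
      field_simp
    rw [Finset.sum_congr rfl this]
    simp
  · have hw : (𝐞 ((t : ℝ) / q) : ℂ) ≠ 1 := by
      intro h1
      rw [fourierChar_eq_one_iff] at h1
      obtain ⟨m, hm⟩ := h1
      apply hdvd
      refine ⟨m, ?_⟩
      have hq' : (q : ℝ) ≠ 0 := by exact_mod_cast hq.ne'
      have : (t : ℝ) = m * q := by
        field_simp at hm
        linarith [hm]
      have : (t : ℤ) = m * q := by exact_mod_cast this
      rw [this]; ring
    have key : ∀ i ∈ range q, (𝐞 (((a + i : ℤ) : ℝ) * t / q) : ℂ) =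
        (𝐞 ((a : ℝ) * t / q) : ℂ) * (𝐞 ((t : ℝ) / q) : ℂ) ^ i := by
      intro i _
      rw [← Circle.coe_pow, ← AddChar.map_nsmul_eq_pow, ← Circle.coe_mul, ← AddChar.map_add_eq_mul]
      congr 2
      push_cast
      rw [nsmul_eq_mul]
      ring
    rw [Finset.sum_congr rfl key, ← Finset.mul_sum, geom_sum_eq hw]
    have hwq : (𝐞 ((t : ℝ) / q) : ℂ) ^ q = 1 := by
      rw [← Circle.coe_pow, ← AddChar.map_nsmul_eq_pow, nsmul_eq_mul,
        show (q : ℝ) * ((t : ℝ) / q) = (t : ℝ) by field_simp, fourierChar_eq_one_iff]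
      exact ⟨t, rfl⟩
    rw [hwq]
    simp

/-! ### Distance to the nearest integer (`distInt` of `VinogradovExpSumTools.lean`) and the Dirichlet kernel -/

/-- A lower bound for `‖x‖_{ℝ/ℤ}`: if `c ≤ |x - m|` for every integer `m` then `c ≤ ‖x‖`.
[folklore] -/
theorem le_distInt_of_forall {x c : ℝ} (h : ∀ m : ℤ, c ≤ |x - m|) : c ≤ distInt x := h _

/-- For `|w| ≤ q/2` the distance from `w/q` to the nearest integer is `|w|/q` (lower bound form).
[folklore] -/
theorem abs_div_le_distInt {q : ℕ} (hq : 0 < q) {w : ℤ} (hw : 2 * |w| ≤ q) :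
    |(w : ℝ)| / q ≤ distInt ((w : ℝ) / q) := by
  have hq' : (0 : ℝ) < q := by exact_mod_cast hq
  have hwq : 2 * |(w : ℝ)| ≤ q := by exact_mod_cast hw
  refine le_distInt_of_forall fun m => ?_
  rcases eq_or_ne m 0 with rfl | hm
  · simp [abs_div, abs_of_pos hq']
  · have hm1 : (1 : ℝ) ≤ |(m : ℝ)| := by
      rw [← Int.cast_abs]; exact_mod_cast Int.one_le_abs hm
    have h1 : |(w : ℝ)| / q ≤ 1 / 2 := by
      rw [div_le_iff₀ hq']; linarith
    have h2 : (1 : ℝ) / 2 ≤ |(w : ℝ) / q - m| := by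
      have := abs_sub_abs_le_abs_sub ((m : ℝ)) ((w : ℝ) / q)
      rw [abs_sub_comm] at this
      have h3 : |(w : ℝ) / q| ≤ 1 / 2 := by rw [abs_div, abs_of_pos hq']; exact h1
      linarith
    linarith

/-- The Dirichlet kernel `D_R(t) = ∑_{r=0}^{R} e(rt)`. [folklore] -/
def dirichletKer (R : ℕ) (t : ℝ) : ℂ := ∑ r ∈ range (R + 1), (𝐞 ((r : ℝ) * t) : ℂ)

/-- Trivial bound `|D_R(t)| ≤ R + 1`. [folklore] -/
theorem norm_dirichletKer_le (R : ℕ) (t : ℝ) : ‖dirichletKer R t‖ ≤ R + 1 := by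
  unfold dirichletKer
  calc ‖∑ r ∈ range (R + 1), (𝐞 ((r : ℝ) * t) : ℂ)‖ ≤ ∑ r ∈ range (R + 1), ‖(𝐞 ((r : ℝ) * t) : ℂ)‖ :=
        norm_sum_le _ _
    _ = R + 1 := by simp

/-- Geometric-sum bound `|D_R(t)| · ‖t‖ ≤ 1/2`. [folklore] -/
theorem norm_dirichletKer_mul_distInt_le (R : ℕ) (t : ℝ) :
    ‖dirichletKer R t‖ * distInt t ≤ 1 / 2 := by
  by_cases hx : distInt t = 0
  · rw [hx, mul_zero]; norm_num
  have hdpos : 0 < distInt t := lt_of_le_of_ne (distInt_nonneg t) (Ne.symm hx)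
  have hsin : 0 < |Real.sin (π * t)| :=
    lt_of_lt_of_le (by linarith) (two_mul_distInt_le_abs_sin t)
  have hne : (𝐞 t : ℂ) - 1 ≠ 0 := by
    intro h0
    have := norm_fourierChar_sub_one t
    rw [h0, norm_zero] at this
    linarith
  have hsum : dirichletKer R t = ∑ j ∈ range (R + 1), (𝐞 t : ℂ) ^ j := by
    unfold dirichletKer
    refine Finset.sum_congr rfl fun j _ => ?_
    rw [← Circle.coe_pow, ← AddChar.map_nsmul_eq_pow, nsmul_eq_mul]
  have hgeom : ∑ j ∈ range (R + 1), (𝐞 t : ℂ) ^ j = ((𝐞 t : ℂ) ^ (R + 1) - 1) / ((𝐞 t : ℂ) - 1) :=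
    geom_sum_eq (fun h1 => hne (by rw [h1, sub_self])) _
  have hnorm : ‖dirichletKer R t‖ ≤ 2 / ‖(𝐞 t : ℂ) - 1‖ := by
    rw [hsum, hgeom, norm_div]
    gcongr
    calc ‖(𝐞 t : ℂ) ^ (R + 1) - 1‖ ≤ ‖(𝐞 t : ℂ) ^ (R + 1)‖ + ‖(1 : ℂ)‖ := norm_sub_le _ _
      _ = 2 := by rw [norm_pow, norm_fourierChar]; norm_num
  rw [norm_fourierChar_sub_one] at hnorm
  calc ‖dirichletKer R t‖ * distInt t
      ≤ 2 / (2 * |Real.sin (π * t)|) * distInt t := by gcongr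
    _ = distInt t / |Real.sin (π * t)| := by field_simp
    _ ≤ distInt t / (2 * distInt t) := by
        gcongr
        exact two_mul_distInt_le_abs_sin t
    _ = 1 / 2 := by field_simp

/-- The Fejér weight `|D_R(w/q)|²` at an integer `w` with `0 < |w| ≤ q/2` is at most `q²/(4w²)`.
[folklore] -/
theorem norm_dirichletKer_sq_le {q : ℕ} (hq : 0 < q) (R : ℕ) {w : ℤ} (hw0 : w ≠ 0)
    (hw : 2 * |w| ≤ q) :
    ‖dirichletKer R ((w : ℝ) / q)‖ ^ 2 ≤ (q : ℝ) ^ 2 / (4 * (w : ℝ) ^ 2) := by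
  have hq' : (0 : ℝ) < q := by exact_mod_cast hq
  have hw' : (0 : ℝ) < |(w : ℝ)| := by
    rw [← Int.cast_abs]; exact_mod_cast abs_pos.mpr hw0
  have hd : |(w : ℝ)| / q ≤ distInt ((w : ℝ) / q) := abs_div_le_distInt hq hw
  have hdpos : 0 < |(w : ℝ)| / q := by positivity
  have h1 := norm_dirichletKer_mul_distInt_le R ((w : ℝ) / q)
  have h2 : ‖dirichletKer R ((w : ℝ) / q)‖ * (|(w : ℝ)| / q) ≤ 1 / 2 :=
    (mul_le_mul_of_nonneg_left hd (norm_nonneg _)).trans h1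
  have h3 : ‖dirichletKer R ((w : ℝ) / q)‖ ≤ q / (2 * |(w : ℝ)|) := by
    rw [le_div_iff₀ (by positivity)]
    have := mul_le_mul_of_nonneg_right h2 (by positivity : (0 : ℝ) ≤ 2 * q)
    calc ‖dirichletKer R ((w : ℝ) / q)‖ * (2 * |(w : ℝ)|)
        = ‖dirichletKer R ((w : ℝ) / q)‖ * (|(w : ℝ)| / q) * (2 * q) := by field_simp
      _ ≤ 1 / 2 * (2 * q) := this
      _ = q := by ring
  calc ‖dirichletKer R ((w : ℝ) / q)‖ ^ 2 ≤ (q / (2 * |(w : ℝ)|)) ^ 2 :=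
        pow_le_pow_left₀ (norm_nonneg _) h3 2
    _ = (q : ℝ) ^ 2 / (4 * (w : ℝ) ^ 2) := by
        rw [div_pow, mul_pow, sq_abs]; norm_num

/-- Expansion of the Fejér weight: `|D_R(t)|² = ∑_{r,s ≤ R} e((r - s)t)`. [folklore] -/
theorem norm_dirichletKer_sq_eq (R : ℕ) (t : ℝ) :
    ((‖dirichletKer R t‖ ^ 2 : ℝ) : ℂ) =
      ∑ p ∈ range (R + 1) ×ˢ range (R + 1), (𝐞 (((p.1 : ℝ) - p.2) * t) : ℂ) := by
  rw [← Complex.normSq_eq_norm_sq, ← Complex.mul_conj, dirichletKer, map_sum, Finset.sum_mul_sum,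
    Finset.sum_product]
  refine Finset.sum_congr rfl fun r _ => Finset.sum_congr rfl fun s _ => ?_
  rw [Circle.starRingEnd_addChar, ← Circle.coe_mul, ← AddChar.map_add_eq_mul]
  congr 2; ring


/-! ### The square wave of period `q`, its Fourier coefficients and its Fejér smoothing -/

/-- The square wave of (even) period `q` on `ℤ`: `+1` on the residues `0, …, q/2 - 1` and `-1` on
the residues `q/2, …, q - 1`. For `q = 2^{j+1}` and `x ∈ ℕ` this is `(-1)^{x_j}`, `x_j` the binary
digit of weight `2^j` (`sqWave_two_pow_eq`), i.e. Green's `ψ(x/2^{j+1})`.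
[cite: Green2012, §3 (the function ψ)] -/
def sqWave (q : ℕ) (y : ℤ) : ℝ := if y % (q : ℤ) < ((q / 2 : ℕ) : ℤ) then 1 else -1

/-- `sqWave q` is `q`-periodic. [folklore] -/
theorem sqWave_add_period (q : ℕ) (y : ℤ) : sqWave q (y + q) = sqWave q y := by
  unfold sqWave
  rw [Int.add_emod_right]

/-- `|sqWave q y| = 1`. [folklore] -/
theorem abs_sqWave (q : ℕ) (y : ℤ) : |sqWave q y| = 1 := by
  unfold sqWave; split_ifs <;> simp

/-- `‖sqWave q y‖ = 1` in `ℂ`. [folklore] -/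
theorem norm_sqWave (q : ℕ) (y : ℤ) : ‖(sqWave q y : ℂ)‖ = 1 := by
  rw [Complex.norm_real, Real.norm_eq_abs, abs_sqWave]

/-- The binary digit of weight `2^j` of `x` as a sign: for `q = 2^{j+1}`,
`sqWave q x = +1` if `x.testBit j = false` and `-1` otherwise. [folklore] -/
theorem sqWave_two_pow_eq (j x : ℕ) :
    sqWave (2 ^ (j + 1)) (x : ℤ) = if x.testBit j then -1 else 1 := by
  unfold sqWave
  have hq2 : (2 ^ (j + 1) / 2 : ℕ) = 2 ^ j := by
    rw [pow_succ, Nat.mul_div_cancel _ Nat.two_pos]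
  rw [hq2, Nat.testBit_eq_decide_div_mod_eq]
  have hmod : ((x : ℤ) % ((2 ^ (j + 1) : ℕ) : ℤ)) = ((x % 2 ^ (j + 1) : ℕ) : ℤ) := by
    push_cast; rfl
  rw [hmod, Nat.mod_pow_succ]
  have hlt : x % 2 ^ j < 2 ^ j := Nat.mod_lt _ (Nat.two_pow_pos j)
  rcases Nat.mod_two_eq_zero_or_one (x / 2 ^ j) with h0 | h1
  · rw [h0]
    simp only [mul_zero, add_zero, zero_ne_one, decide_false]
    rw [if_pos (by exact_mod_cast hlt)]
    simp
  · rw [h1]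
    simp only [mul_one, decide_true]
    rw [if_neg (by norm_cast; exact not_lt.mpr (Nat.le_add_left _ _))]
    simp

/-- The `d`-th Fourier coefficient of the square wave of period `q`:
`ĝ(d) = q⁻¹ ∑_{i<q} g(i) e(-id/q)`. [folklore] -/
def sqCoeff (q : ℕ) (d : ℤ) : ℂ :=
  (∑ i ∈ range q, (sqWave q i : ℂ) * (𝐞 (-((i : ℝ) * d / q)) : ℂ)) / q

/-- `|ĝ(d)| ≤ 1`. [folklore] -/
theorem norm_sqCoeff_le_one (q : ℕ) (d : ℤ) : ‖sqCoeff q d‖ ≤ 1 := by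
  rcases Nat.eq_zero_or_pos q with rfl | hq
  · simp [sqCoeff]
  unfold sqCoeff
  rw [norm_div, Complex.norm_natCast, div_le_one (by exact_mod_cast hq)]
  calc ‖∑ i ∈ range q, (sqWave q i : ℂ) * (𝐞 (-((i : ℝ) * d / q)) : ℂ)‖
      ≤ ∑ i ∈ range q, ‖(sqWave q i : ℂ) * (𝐞 (-((i : ℝ) * d / q)) : ℂ)‖ := norm_sum_le _ _
    _ = q := by simp [abs_sqWave]

/-- The Fejér weight at the integer `i`: `K(i) = |D_R(i/q)|²`. [folklore] -/
def fejerWeight (q R : ℕ) (i : ℤ) : ℝ := ‖dirichletKer R ((i : ℝ) / q)‖ ^ 2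

/-- `K(i) ≥ 0`. [folklore] -/
theorem fejerWeight_nonneg (q R : ℕ) (i : ℤ) : 0 ≤ fejerWeight q R i := sq_nonneg _

/-- `K` is `q`-periodic. [folklore] -/
theorem fejerWeight_add_period {q : ℕ} (hq : 0 < q) (R : ℕ) (i : ℤ) :
    fejerWeight q R (i + q) = fejerWeight q R i := by
  unfold fejerWeight dirichletKer
  congr 2
  refine Finset.sum_congr rfl fun r _ => ?_
  have hq' : (q : ℝ) ≠ 0 := by exact_mod_cast hq.ne'
  have : (r : ℝ) * (((i + q : ℤ) : ℝ) / q) = (r : ℝ) * ((i : ℝ) / q) + (r : ℤ) := by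
    push_cast; field_simp
  rw [this, AddChar.map_add_eq_mul, Circle.coe_mul]
  have h1 : (𝐞 ((r : ℤ) : ℝ) : ℂ) = 1 := (fourierChar_eq_one_iff _).2 ⟨r, rfl⟩
  rw [h1, mul_one]

/-- **The Fejér smoothing of the square wave**:
`P(x) = (q(R+1))⁻¹ ∑_{i<q} |D_R(i/q)|² g(x+i)`, an average of the values of `g` over the window
`[x, x+q)` against the Fejér weights. [folklore] -/
def fejerApprox (q R : ℕ) (x : ℤ) : ℂ :=
  (∑ i ∈ range q, (fejerWeight q R i : ℂ) * (sqWave q (x + i) : ℂ)) / ((q : ℂ) * (R + 1))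

/-- `P` is `q`-periodic. [folklore] -/
theorem fejerApprox_add_period (q R : ℕ) (x : ℤ) :
    fejerApprox q R (x + q) = fejerApprox q R x := by
  unfold fejerApprox
  congr 1
  refine Finset.sum_congr rfl fun i _ => ?_
  rw [show x + q + i = x + i + q by ring, sqWave_add_period]

/-- For `0 ≤ r, s ≤ R < q`, `q ∣ r - s` forces `r = s`. [folklore] -/
theorem eq_of_dvd_sub_of_lt {q R : ℕ} (hRq : R + 1 ≤ q) {r s : ℕ} (hr : r < R + 1) (hs : s < R + 1)
    (h : (q : ℤ) ∣ (r : ℤ) - s) : r = s := by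
  obtain ⟨c, hc⟩ := h
  rcases lt_trichotomy c 0 with hc0 | rfl | hc0
  · have : (r : ℤ) - s ≤ -q := by
      rw [hc]
      have : c ≤ -1 := by omega
      nlinarith
    omega
  · omega
  · have : (q : ℤ) ≤ (r : ℤ) - s := by
      rw [hc]
      have : 1 ≤ c := by omega
      nlinarith
    omega

/-- **Mass of the Fejér weights**: `∑_{i<q} |D_R(i/q)|² = q(R+1)` for `R + 1 ≤ q`
(expand the square and use orthogonality). [folklore] -/
theorem sum_fejerWeight {q R : ℕ} (hRq : R + 1 ≤ q) :
    ∑ i ∈ range q, (fejerWeight q R i : ℂ) = (q : ℂ) * (R + 1) := by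
  have hq : 0 < q := by omega
  unfold fejerWeight
  simp_rw [norm_dirichletKer_sq_eq]
  rw [Finset.sum_comm]
  have key : ∀ p ∈ range (R + 1) ×ˢ range (R + 1),
      ∑ i ∈ range q, (𝐞 (((p.1 : ℝ) - p.2) * (((i : ℤ) : ℝ) / q)) : ℂ) =
        if p.1 = p.2 then (q : ℂ) else 0 := by
    intro p hp
    rw [Finset.mem_product, Finset.mem_range, Finset.mem_range] at hp
    have h := sum_range_fourierChar_div q hq 0 ((p.1 : ℤ) - p.2)
    have h' : ∀ i ∈ range q, (𝐞 (((p.1 : ℝ) - p.2) * (((i : ℤ) : ℝ) / q)) : ℂ) =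
        (𝐞 ((((0 : ℤ) + i : ℤ) : ℝ) * (((p.1 : ℤ) - p.2 : ℤ)) / q) : ℂ) := by
      intro i _
      congr 2; push_cast; ring
    rw [Finset.sum_congr rfl h', h]
    by_cases hps : p.1 = p.2
    · rw [if_pos hps, if_pos (by rw [hps, sub_self]; exact dvd_zero _)]
    · rw [if_neg hps, if_neg (fun hd => hps (eq_of_dvd_sub_of_lt hRq hp.1 hp.2 hd))]
  rw [Finset.sum_congr rfl key, Finset.sum_ite, Finset.sum_const_zero, add_zero, Finset.sum_const,
    nsmul_eq_mul]
  have hcard : ((range (R + 1) ×ˢ range (R + 1)).filter (fun p : ℕ × ℕ => p.1 = p.2)).card = R + 1 := by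
    rw [show (range (R + 1) ×ˢ range (R + 1)).filter (fun p : ℕ × ℕ => p.1 = p.2) =
        (range (R + 1)).map ⟨fun r => (r, r), fun a b h => (Prod.mk.inj h).1⟩ by
      ext ⟨r, s⟩
      simp only [Finset.mem_filter, Finset.mem_product, Finset.mem_range, Finset.mem_map,
        Function.Embedding.coeFn_mk, Prod.mk.injEq]
      constructor
      · rintro ⟨⟨hr, _⟩, rfl⟩; exact ⟨r, hr, rfl, rfl⟩
      · rintro ⟨a, ha, rfl, rfl⟩; exact ⟨⟨ha, ha⟩, rfl⟩]
    rw [Finset.card_map, Finset.card_range]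
  rw [hcard]; push_cast; ring

/-- Real form of the mass identity. [folklore] -/
theorem sum_fejerWeight_real {q R : ℕ} (hRq : R + 1 ≤ q) :
    ∑ i ∈ range q, fejerWeight q R i = (q : ℝ) * (R + 1) := by
  have h := sum_fejerWeight hRq
  exact_mod_cast h

/-- `|P(x)| ≤ 1`: `P(x)` is an average of values `±1`. [folklore] -/
theorem norm_fejerApprox_le_one {q R : ℕ} (hRq : R + 1 ≤ q) (x : ℤ) :
    ‖fejerApprox q R x‖ ≤ 1 := by
  have hq : 0 < q := by omega
  unfold fejerApprox
  have hden : (0 : ℝ) < (q : ℝ) * (R + 1) := by positivity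
  rw [norm_div]
  have hn : ‖(q : ℂ) * (R + 1)‖ = (q : ℝ) * (R + 1) := by
    rw [show (q : ℂ) * (R + 1) = (((q : ℝ) * (R + 1) : ℝ) : ℂ) by push_cast; ring, Complex.norm_real,
      Real.norm_eq_abs, abs_of_pos hden]
  rw [hn, div_le_one hden]
  calc ‖∑ i ∈ range q, (fejerWeight q R i : ℂ) * (sqWave q (x + i) : ℂ)‖
      ≤ ∑ i ∈ range q, ‖(fejerWeight q R i : ℂ) * (sqWave q (x + i) : ℂ)‖ := norm_sum_le _ _
    _ = ∑ i ∈ range q, fejerWeight q R i := by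
        refine Finset.sum_congr rfl fun i _ => ?_
        rw [norm_mul, norm_sqWave, mul_one, Complex.norm_real, Real.norm_eq_abs,
          abs_of_nonneg (fejerWeight_nonneg q R i)]
    _ = (q : ℝ) * (R + 1) := sum_fejerWeight_real hRq

/-- Shifting a full period of the twisted square wave: for every `x ∈ ℤ`,
`∑_{i<q} g(x+i) e(-(x+i)d/q) = q ĝ(d)`. [folklore] -/
theorem sum_sqWave_mul_fourierChar_shift {q : ℕ} (hq : 0 < q) (d x : ℤ) :
    ∑ i ∈ range q, (sqWave q (x + i) : ℂ) * (𝐞 (-(((x + i : ℤ) : ℝ) * d / q)) : ℂ) =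
      (q : ℂ) * sqCoeff q d := by
  have hq' : (q : ℂ) ≠ 0 := by exact_mod_cast hq.ne'
  unfold sqCoeff
  rw [mul_div_cancel₀ _ hq']
  set G : ℤ → ℂ := fun y => (sqWave q y : ℂ) * (𝐞 (-((y : ℝ) * d / q)) : ℂ) with hG
  have hper : ∀ y : ℤ, G (y + q) = G y := by
    intro y
    simp only [hG]
    rw [sqWave_add_period]
    congr 1
    have hqr : (q : ℝ) ≠ 0 := by exact_mod_cast hq.ne'
    have : -(((y + q : ℤ) : ℝ) * d / q) = -((y : ℝ) * d / q) + ((-d : ℤ) : ℝ) := by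
      push_cast; field_simp; ring
    rw [this, AddChar.map_add_eq_mul, Circle.coe_mul, (fourierChar_eq_one_iff _).2 ⟨-d, rfl⟩, mul_one]
  have h := sum_range_add_eq_of_periodic G q hper x
  have hR : ∑ i ∈ range q, (sqWave q i : ℂ) * (𝐞 (-((i : ℝ) * d / q)) : ℂ) = ∑ i ∈ range q, G i := by
    refine Finset.sum_congr rfl fun i _ => ?_
    simp only [hG]; push_cast; ring_nf
  rw [hR, ← h]

/-- **The Fejér smoothing is a trigonometric polynomial of degree `R`**:
`P(x) = (R+1)⁻¹ ∑_{0 ≤ r, s ≤ R} ĝ(s - r) e((s - r)x/q)`. [folklore] -/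
theorem fejerApprox_eq_sum {q R : ℕ} (hq : 0 < q) (x : ℤ) :
    fejerApprox q R x = ∑ p ∈ range (R + 1) ×ˢ range (R + 1),
      sqCoeff q ((p.2 : ℤ) - p.1) / (R + 1) * (𝐞 ((((p.2 : ℤ) - p.1 : ℤ) : ℝ) * x / q) : ℂ) := by
  have hq' : (q : ℂ) ≠ 0 := by exact_mod_cast hq.ne'
  have hR : ((R : ℂ) + 1) ≠ 0 := by exact_mod_cast Nat.succ_ne_zero R
  unfold fejerApprox fejerWeight
  simp_rw [norm_dirichletKer_sq_eq, Finset.sum_mul]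
  rw [Finset.sum_comm, Finset.sum_div]
  refine Finset.sum_congr rfl fun p _ => ?_
  have key : ∀ i ∈ range q,
      (𝐞 (((p.1 : ℝ) - p.2) * (((i : ℤ) : ℝ) / q)) : ℂ) * (sqWave q (x + i) : ℂ) =
        (𝐞 ((((p.2 : ℤ) - p.1 : ℤ) : ℝ) * x / q) : ℂ) *
          ((sqWave q (x + i) : ℂ) * (𝐞 (-(((x + i : ℤ) : ℝ) * (((p.2 : ℤ) - p.1 : ℤ)) / q)) : ℂ)) := by
    intro i _
    rw [mul_comm, mul_left_comm, ← Circle.coe_mul, ← AddChar.map_add_eq_mul]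
    congr 3
    push_cast; ring
  rw [Finset.sum_congr rfl key, ← Finset.mul_sum, sum_sqWave_mul_fourierChar_shift hq]
  field_simp


/-! ### The `L¹` error of the Fejér smoothing -/

/-- `Φ(w) = ∑_{i<q} |g(i) - g(i+w)|`: twice the number of residues at which the square wave and
its shift by `w` disagree. [folklore] -/
def flipSum (q : ℕ) (w : ℤ) : ℝ := ∑ i ∈ range q, |sqWave q i - sqWave q (i + w)|

/-- `Φ(w) ≥ 0`. [folklore] -/
theorem flipSum_nonneg (q : ℕ) (w : ℤ) : 0 ≤ flipSum q w :=
  Finset.sum_nonneg fun _ _ => abs_nonneg _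

/-- `Φ(1) ≤ 4`: a shift by one changes the square wave (of even period `q ≥ 2`) only at the two
residues `q/2 - 1` and `q - 1`. [folklore] -/
theorem flipSum_one_le {q : ℕ} (hq : 2 ≤ q) (hqe : Even q) : flipSum q 1 ≤ 4 := by
  obtain ⟨h, rfl⟩ := hqe
  have hh : 1 ≤ h := by omega
  have hq2 : (h + h) / 2 = h := by omega
  unfold flipSum
  have key : ∀ i ∈ range (h + h),
      |sqWave (h + h) i - sqWave (h + h) (i + 1)| ≤
        2 * (if i = h - 1 then 1 else 0) + 2 * (if i = h + h - 1 then 1 else 0) := by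
    intro i hi
    rw [Finset.mem_range] at hi
    have h2 : |sqWave (h + h) i - sqWave (h + h) (i + 1)| ≤ 2 :=
      calc |sqWave (h + h) i - sqWave (h + h) (i + 1)|
          ≤ |sqWave (h + h) i| + |sqWave (h + h) (i + 1)| := abs_sub _ _
        _ = 2 := by rw [abs_sqWave, abs_sqWave]; norm_num
    by_cases hi1 : i = h - 1
    · rw [if_pos hi1]; split_ifs <;> linarith
    by_cases hi2 : i = h + h - 1
    · rw [if_pos hi2, if_neg hi1]; linarith
    rw [if_neg hi1, if_neg hi2]
    have e1 : ((i : ℤ)) % ((h + h : ℕ) : ℤ) = i := Int.emod_eq_of_lt (by positivity) (by exact_mod_cast hi)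
    have e2 : ((i : ℤ) + 1) % ((h + h : ℕ) : ℤ) = i + 1 :=
      Int.emod_eq_of_lt (by positivity) (by push_cast; omega)
    unfold sqWave
    rw [hq2, e1, e2]
    by_cases hlt : i < h - 1
    · rw [if_pos (by exact_mod_cast (by omega : i < h)), if_pos (by omega)]
      simp
    · rw [if_neg (by omega), if_neg (by omega)]
      simp
  calc ∑ i ∈ range (h + h), |sqWave (h + h) i - sqWave (h + h) (i + 1)|
      ≤ ∑ i ∈ range (h + h), (2 * (if i = h - 1 then 1 else 0) + 2 * (if i = h + h - 1 then 1 else 0) : ℝ) :=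
        Finset.sum_le_sum key
    _ = 2 * (if h - 1 ∈ range (h + h) then 1 else 0) + 2 * (if h + h - 1 ∈ range (h + h) then 1 else 0) := by
        rw [Finset.sum_add_distrib, ← Finset.mul_sum, ← Finset.mul_sum, Finset.sum_ite_eq',
          Finset.sum_ite_eq']
    _ ≤ 4 := by split_ifs <;> norm_num

/-- Subadditivity `Φ(w₁ + w₂) ≤ Φ(w₁) + Φ(w₂)` (triangle inequality and a shift of the period).
[folklore] -/
theorem flipSum_add_le (q : ℕ) (w₁ w₂ : ℤ) : flipSum q (w₁ + w₂) ≤ flipSum q w₁ + flipSum q w₂ := by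
  unfold flipSum
  have hshift : ∑ i ∈ range q, |sqWave q (i + w₁) - sqWave q (i + w₁ + w₂)| =
      ∑ i ∈ range q, |sqWave q i - sqWave q (i + w₂)| := by
    have h := sum_range_add_eq_of_periodic (fun y : ℤ => |sqWave q y - sqWave q (y + w₂)|) q
      (fun y => by
        rw [show y + q + w₂ = y + w₂ + q by ring, sqWave_add_period, sqWave_add_period]) w₁
    rw [← h]
    refine Finset.sum_congr rfl fun i _ => ?_
    ring_nf
  rw [← hshift, ← Finset.sum_add_distrib]
  refine Finset.sum_le_sum fun i _ => ?_
  rw [show (i : ℤ) + (w₁ + w₂) = i + w₁ + w₂ by ring]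
  exact abs_sub_le _ _ _

/-- `Φ(-w) = Φ(w)`. [folklore] -/
theorem flipSum_neg (q : ℕ) (w : ℤ) : flipSum q (-w) = flipSum q w := by
  unfold flipSum
  have h := sum_range_add_eq_of_periodic (fun y : ℤ => |sqWave q (y + w) - sqWave q y|) q
    (fun y => by
      rw [show y + q + w = y + w + q by ring, sqWave_add_period, sqWave_add_period]) (-w)
  calc ∑ i ∈ range q, |sqWave q i - sqWave q (i + -w)|
      = ∑ i ∈ range q, |sqWave q (-w + i + w) - sqWave q (-w + i)| := by
        refine Finset.sum_congr rfl fun i _ => ?_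
        rw [show -w + (i : ℤ) + w = i by ring, show (i : ℤ) + -w = -w + i by ring]
    _ = ∑ i ∈ range q, |sqWave q (i + w) - sqWave q i| := h
    _ = ∑ i ∈ range q, |sqWave q i - sqWave q (i + w)| :=
        Finset.sum_congr rfl fun i _ => abs_sub_comm _ _

/-- `Φ(w + q) = Φ(w)`. [folklore] -/
theorem flipSum_add_period (q : ℕ) (w : ℤ) : flipSum q (w + q) = flipSum q w := by
  unfold flipSum
  refine Finset.sum_congr rfl fun i _ => ?_
  rw [show (i : ℤ) + (w + q) = i + w + q by ring, sqWave_add_period]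

/-- `Φ(n) ≤ 4n` for `n ∈ ℕ`. [folklore] -/
theorem flipSum_natCast_le {q : ℕ} (hq : 2 ≤ q) (hqe : Even q) (n : ℕ) :
    flipSum q (n : ℤ) ≤ 4 * n := by
  induction n with
  | zero => simp [flipSum]
  | succ n ih =>
      have h := flipSum_add_le q (n : ℤ) 1
      have h1 := flipSum_one_le hq hqe
      push_cast at h ⊢
      linarith

/-- `Φ(i) ≤ 4(q - i)` for `i ≤ q`. [folklore] -/
theorem flipSum_le_sub {q : ℕ} (hq : 2 ≤ q) (hqe : Even q) {i : ℕ} (hi : i ≤ q) :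
    flipSum q (i : ℤ) ≤ 4 * ((q : ℝ) - i) := by
  have h1 : flipSum q (i : ℤ) = flipSum q ((q : ℤ) - i) := by
    rw [← flipSum_neg q ((q : ℤ) - i), ← flipSum_add_period q (-((q : ℤ) - i))]
    congr 1; ring
  rw [h1]
  have := flipSum_natCast_le hq hqe (q - i)
  push_cast [hi] at this
  exact this

/-- `K(i) ≤ (R+1)²`. [folklore] -/
theorem fejerWeight_le_sq (q R : ℕ) (i : ℤ) : fejerWeight q R i ≤ ((R : ℝ) + 1) ^ 2 :=
  pow_le_pow_left₀ (norm_nonneg _) (norm_dirichletKer_le R _) 2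

/-- `K(i) ≤ q²/(4i²)` for `1 ≤ i ≤ q/2`. [folklore] -/
theorem fejerWeight_le_left {q : ℕ} (hq : 0 < q) (R : ℕ) {i : ℕ} (hi0 : 1 ≤ i) (hi : 2 * i ≤ q) :
    fejerWeight q R i ≤ (q : ℝ) ^ 2 / (4 * (i : ℝ) ^ 2) := by
  have h := norm_dirichletKer_sq_le hq R (w := (i : ℤ)) (by exact_mod_cast (by omega : i ≠ 0))
    (by rw [Nat.abs_cast]; exact_mod_cast hi)
  unfold fejerWeight
  simp only [Int.cast_natCast] at h ⊢
  exact h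

/-- `K(i) ≤ q²/(4(q-i)²)` for `q/2 ≤ i < q`. [folklore] -/
theorem fejerWeight_le_right {q : ℕ} (hq : 0 < q) (R : ℕ) {i : ℕ} (hiq : i < q) (hi : q ≤ 2 * i) :
    fejerWeight q R i ≤ (q : ℝ) ^ 2 / (4 * ((q : ℝ) - i) ^ 2) := by
  have hper : fejerWeight q R i = fejerWeight q R ((i : ℤ) - q) := by
    rw [← fejerWeight_add_period hq R ((i : ℤ) - q)]
    congr 1; ring
  rw [hper]
  have h := norm_dirichletKer_sq_le hq R (w := (i : ℤ) - q) (by omega)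
    (by rw [abs_of_nonpos (by omega)]; omega)
  unfold fejerWeight
  have e : (((i : ℤ) - q : ℤ) : ℝ) ^ 2 = ((q : ℝ) - i) ^ 2 := by push_cast; ring
  rw [e] at h
  exact h

/-- Pointwise form of the smoothing error:
`g(x) - P(x) = (q(R+1))⁻¹ ∑_{i<q} K(i) (g(x) - g(x+i))`. [folklore] -/
theorem sqWave_sub_fejerApprox {q R : ℕ} (hRq : R + 1 ≤ q) (x : ℤ) :
    (sqWave q x : ℂ) - fejerApprox q R x =
      (∑ i ∈ range q, (fejerWeight q R i : ℂ) * ((sqWave q x : ℂ) - sqWave q (x + i))) /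
        ((q : ℂ) * (R + 1)) := by
  have hq : 0 < q := by omega
  have hden : (q : ℂ) * (R + 1) ≠ 0 := by
    have : ((q : ℂ) * (R + 1)) = (((q * (R + 1) : ℕ)) : ℂ) := by push_cast; ring
    rw [this]; exact_mod_cast (by positivity : q * (R + 1) ≠ 0)
  unfold fejerApprox
  rw [eq_div_iff hden, sub_mul, div_mul_cancel₀ _ hden]
  simp_rw [mul_sub, Finset.sum_sub_distrib, ← Finset.sum_mul, sum_fejerWeight hRq]
  ring

/-- **`L¹` error of the Fejér smoothing over one period**: for even `q ≥ 2(R+1)`,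
`∑_{x<q} |g(x) - P(x)| ≤ 4q/√(R+1)`. [folklore] -/
theorem sum_norm_sqWave_sub_fejerApprox_le {q R : ℕ} (hqe : Even q) (hRq : 2 * (R + 1) ≤ q) :
    ∑ x ∈ range q, ‖(sqWave q x : ℂ) - fejerApprox q R x‖ ≤ 4 * q / Real.sqrt (R + 1) := by
  have hq2 : 2 ≤ q := by omega
  have hq : 0 < q := by omega
  have hRq' : R + 1 ≤ q := by omega
  have hR1 : (0 : ℝ) < (R : ℝ) + 1 := by positivity
  have hqR : (0 : ℝ) < (q : ℝ) * (R + 1) := by positivity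
  -- Step 1–2: pointwise bound
  have hpt : ∀ x : ℤ, ‖(sqWave q x : ℂ) - fejerApprox q R x‖ ≤
      (∑ i ∈ range q, fejerWeight q R i * |sqWave q x - sqWave q (x + i)|) / ((q : ℝ) * (R + 1)) := by
    intro x
    rw [sqWave_sub_fejerApprox hRq', norm_div]
    have hn : ‖(q : ℂ) * (R + 1)‖ = (q : ℝ) * (R + 1) := by
      rw [show (q : ℂ) * (R + 1) = (((q : ℝ) * (R + 1) : ℝ) : ℂ) by push_cast; ring, Complex.norm_real,
        Real.norm_eq_abs, abs_of_pos hqR]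
    rw [hn]
    gcongr
    refine (norm_sum_le _ _).trans (le_of_eq (Finset.sum_congr rfl fun i _ => ?_))
    rw [norm_mul, Complex.norm_real, Real.norm_eq_abs, abs_of_nonneg (fejerWeight_nonneg q R i),
      ← Complex.ofReal_sub, Complex.norm_real, Real.norm_eq_abs]
  -- Step 3: sum over a period and swap
  have hswap : ∑ x ∈ range q, (∑ i ∈ range q, fejerWeight q R i * |sqWave q x - sqWave q (x + i)|) =
      ∑ i ∈ range q, fejerWeight q R i * flipSum q i := by
    rw [Finset.sum_comm]
    refine Finset.sum_congr rfl fun i _ => ?_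
    rw [flipSum, Finset.mul_sum]
  -- Step 4: the weighted flip sums
  set m : ℕ := q / (2 * (R + 1)) with hm
  have hm1 : 1 ≤ m := (Nat.le_div_iff_mul_le (by positivity)).2 (by simpa using hRq)
  have hmle : (m : ℝ) * (2 * (R + 1)) ≤ q := by
    have := Nat.div_mul_le_self q (2 * (R + 1))
    exact_mod_cast this
  have hmlt : (q : ℝ) < ((m : ℝ) + 1) * (2 * (R + 1)) := by
    have := Nat.lt_div_mul_add (a := q) (b := 2 * (R + 1)) (by positivity)
    rw [← hm] at this
    have : q < (m + 1) * (2 * (R + 1)) := by rw [add_mul, one_mul]; exact this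
    exact_mod_cast this
  have hmq : m ≤ q / 2 := by
    rw [hm]; exact Nat.div_le_div_left (by omega) (by norm_num)
  set b : ℕ → ℝ := fun v => if v ≤ m then 4 * v * ((R : ℝ) + 1) ^ 2 else (q : ℝ) ^ 2 / v with hb
  have hb_nonneg : ∀ v, 0 ≤ b v := fun v => by simp only [hb]; split_ifs <;> positivity
  -- pointwise: left half
  have hleft : ∀ i ∈ Ioc 0 (q / 2), fejerWeight q R i * flipSum q i ≤ b i := by
    intro i hi
    rw [Finset.mem_Ioc] at hi
    have hf := flipSum_natCast_le hq2 hqe i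
    simp only [hb]
    split_ifs with him
    · calc fejerWeight q R i * flipSum q i ≤ ((R : ℝ) + 1) ^ 2 * (4 * i) :=
            mul_le_mul (fejerWeight_le_sq q R i) hf (flipSum_nonneg _ _) (by positivity)
        _ = 4 * i * ((R : ℝ) + 1) ^ 2 := by ring
    · have hi0 : (0 : ℝ) < i := by exact_mod_cast hi.1
      calc fejerWeight q R i * flipSum q i ≤ (q : ℝ) ^ 2 / (4 * (i : ℝ) ^ 2) * (4 * i) :=
            mul_le_mul (fejerWeight_le_left hq R hi.1 (by omega)) hf (flipSum_nonneg _ _) (by positivity)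
        _ = (q : ℝ) ^ 2 / i := by field_simp
  -- pointwise: right half
  have hright : ∀ i ∈ Ioo (q / 2) q, fejerWeight q R i * flipSum q i ≤ b (q - i) := by
    intro i hi
    rw [Finset.mem_Ioo] at hi
    have hf := flipSum_le_sub hq2 hqe hi.2.le
    have hqi : ((q - i : ℕ) : ℝ) = (q : ℝ) - i := by push_cast [hi.2.le]; ring
    simp only [hb]
    split_ifs with him
    · calc fejerWeight q R i * flipSum q i ≤ ((R : ℝ) + 1) ^ 2 * (4 * ((q : ℝ) - i)) :=
            mul_le_mul (fejerWeight_le_sq q R i) hf (flipSum_nonneg _ _) (by positivity)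
        _ = 4 * ((q - i : ℕ) : ℝ) * ((R : ℝ) + 1) ^ 2 := by rw [hqi]; ring
    · have hi0 : (0 : ℝ) < (q : ℝ) - i := by
        have : (i : ℝ) < q := by exact_mod_cast hi.2
        linarith
      calc fejerWeight q R i * flipSum q i ≤ (q : ℝ) ^ 2 / (4 * ((q : ℝ) - i) ^ 2) * (4 * ((q : ℝ) - i)) :=
            mul_le_mul (fejerWeight_le_right hq R hi.2 (by omega)) hf (flipSum_nonneg _ _) (by positivity)
        _ = (q : ℝ) ^ 2 / ((q - i : ℕ) : ℝ) := by rw [hqi]; field_simp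
  -- summing the halves
  have hsplit : range q = insert 0 (Ioc 0 (q / 2) ∪ Ioo (q / 2) q) := by
    ext i
    simp only [Finset.mem_range, Finset.mem_insert, Finset.mem_union, Finset.mem_Ioc, Finset.mem_Ioo]
    omega
  have hdisj : Disjoint (Ioc 0 (q / 2)) (Ioo (q / 2) q) := by
    rw [Finset.disjoint_left]
    intro i h1 h2
    rw [Finset.mem_Ioc] at h1
    rw [Finset.mem_Ioo] at h2
    omega
  have h0 : fejerWeight q R ((0 : ℕ) : ℤ) * flipSum q ((0 : ℕ) : ℤ) = 0 := by
    simp [flipSum]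
  have hsum4 : ∑ i ∈ range q, fejerWeight q R i * flipSum q i ≤ 2 * ∑ v ∈ Icc 1 (q / 2), b v := by
    rw [hsplit, Finset.sum_insert (by simp), h0, zero_add, Finset.sum_union hdisj, two_mul]
    gcongr with i hi
    · -- left
      rw [show Icc 1 (q / 2) = Ioc 0 (q / 2) by ext i; simp only [Finset.mem_Icc, Finset.mem_Ioc]; omega]
      exact Finset.sum_le_sum hleft
    · -- right: reindex `i ↦ q - i`
      calc ∑ i ∈ Ioo (q / 2) q, fejerWeight q R i * flipSum q i
          ≤ ∑ i ∈ Ioo (q / 2) q, b (q - i) := Finset.sum_le_sum hright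
        _ = ∑ v ∈ Ioo 0 (q - q / 2), b v := by
            refine Finset.sum_nbij' (fun i => q - i) (fun v => q - v) ?_ ?_ ?_ ?_ ?_
            · intro i hi; rw [Finset.mem_Ioo] at hi ⊢; omega
            · intro v hv; rw [Finset.mem_Ioo] at hv ⊢; omega
            · intro i hi; rw [Finset.mem_Ioo] at hi; omega
            · intro v hv; rw [Finset.mem_Ioo] at hv; omega
            · intro i _; rfl
        _ ≤ ∑ v ∈ Icc 1 (q / 2), b v := by
            refine Finset.sum_le_sum_of_subset_of_nonneg (fun v hv => ?_) (fun v _ _ => hb_nonneg v)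
            rw [Finset.mem_Ioo] at hv
            rw [Finset.mem_Icc]
            obtain ⟨h, rfl⟩ := hqe
            omega
  -- Step 5: the two ranges of `v`
  have hIcc : Icc 1 (q / 2) = Icc 1 m ∪ Ioc m (q / 2) := by
    ext v; simp only [Finset.mem_Icc, Finset.mem_union, Finset.mem_Ioc]; omega
  have hdisj2 : Disjoint (Icc 1 m) (Ioc m (q / 2)) := by
    rw [Finset.disjoint_left]
    intro v h1 h2
    rw [Finset.mem_Icc] at h1
    rw [Finset.mem_Ioc] at h2
    omega
  have hb1 : ∑ v ∈ Icc 1 m, b v ≤ (q : ℝ) ^ 2 := by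
    calc ∑ v ∈ Icc 1 m, b v ≤ ∑ v ∈ Icc 1 m, 4 * (m : ℝ) * ((R : ℝ) + 1) ^ 2 := by
          refine Finset.sum_le_sum fun v hv => ?_
          rw [Finset.mem_Icc] at hv
          simp only [hb, if_pos hv.2]
          gcongr
          exact_mod_cast hv.2
      _ = (m : ℝ) * (4 * m * ((R : ℝ) + 1) ^ 2) := by
          rw [Finset.sum_const, Nat.card_Icc, nsmul_eq_mul]
          push_cast
          ring
      _ = ((m : ℝ) * (2 * (R + 1))) ^ 2 := by ring
      _ ≤ (q : ℝ) ^ 2 := pow_le_pow_left₀ (by positivity) hmle 2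
  have hb2 : ∑ v ∈ Ioc m (q / 2), b v ≤ (q : ℝ) ^ 2 * (1 + Real.log (R + 1)) := by
    have hharm : ∑ v ∈ Ioc m (q / 2), (1 : ℝ) / v ≤ 1 + Real.log (R + 1) := by
      have hH : ∑ v ∈ Ioc m (q / 2), (1 : ℝ) / v =
          (harmonic (q / 2) : ℝ) - (harmonic m : ℝ) := by
        simp_rw [harmonic_eq_sum_Icc, Rat.cast_sum, Rat.cast_inv, Rat.cast_natCast]
        rw [hIcc, Finset.sum_union hdisj2]
        simp only [one_div]
        ring
      rw [hH]
      have h1 := harmonic_le_one_add_log (q / 2)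
      have h2 := log_add_one_le_harmonic m
      have h3 : Real.log ((q / 2 : ℕ) : ℝ) ≤ Real.log ((m + 1 : ℕ) : ℝ) + Real.log (R + 1) := by
        rw [← Real.log_mul (by positivity) (by positivity)]
        rcases Nat.eq_zero_or_pos (q / 2) with h0 | hpos
        · rw [h0]; simp only [Nat.cast_zero, Real.log_zero]
          exact Real.log_nonneg (by push_cast; nlinarith)
        · refine Real.log_le_log (by exact_mod_cast hpos) ?_
          have : ((q / 2 : ℕ) : ℝ) ≤ (q : ℝ) / 2 := Nat.cast_div_le
          push_cast
          nlinarith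
      linarith
    calc ∑ v ∈ Ioc m (q / 2), b v = ∑ v ∈ Ioc m (q / 2), (q : ℝ) ^ 2 * (1 / v) := by
          refine Finset.sum_congr rfl fun v hv => ?_
          rw [Finset.mem_Ioc] at hv
          simp only [hb, if_neg (by omega : ¬ v ≤ m)]
          ring
      _ = (q : ℝ) ^ 2 * ∑ v ∈ Ioc m (q / 2), (1 : ℝ) / v := by rw [Finset.mul_sum]
      _ ≤ (q : ℝ) ^ 2 * (1 + Real.log (R + 1)) := by gcongr
  have hbsum : ∑ v ∈ Icc 1 (q / 2), b v ≤ (q : ℝ) ^ 2 * (2 + Real.log (R + 1)) := by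
    rw [hIcc, Finset.sum_union hdisj2]
    nlinarith [hb1, hb2]
  -- assembling
  have hlog : 2 + Real.log ((R : ℝ) + 1) ≤ 2 * Real.sqrt (R + 1) := by
    have hs : 0 < Real.sqrt ((R : ℝ) + 1) := Real.sqrt_pos.2 hR1
    have h1 := Real.log_le_sub_one_of_pos hs
    have h2 : Real.log ((R : ℝ) + 1) = 2 * Real.log (Real.sqrt (R + 1)) := by
      rw [Real.log_sqrt hR1.le]; ring
    rw [h2]; linarith
  calc ∑ x ∈ range q, ‖(sqWave q x : ℂ) - fejerApprox q R x‖
      ≤ ∑ x ∈ range q, (∑ i ∈ range q, fejerWeight q R i * |sqWave q x - sqWave q (x + i)|) /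
          ((q : ℝ) * (R + 1)) := Finset.sum_le_sum fun x _ => hpt x
    _ = (∑ i ∈ range q, fejerWeight q R i * flipSum q i) / ((q : ℝ) * (R + 1)) := by
        rw [← Finset.sum_div, hswap]
    _ ≤ 2 * ((q : ℝ) ^ 2 * (2 + Real.log (R + 1))) / ((q : ℝ) * (R + 1)) := by
        gcongr
        exact hsum4.trans (by linarith)
    _ = 2 * q * (2 + Real.log (R + 1)) / (R + 1) := by field_simp
    _ ≤ 2 * q * (2 * Real.sqrt (R + 1)) / (R + 1) := by gcongr
    _ = 4 * q / Real.sqrt (R + 1) := by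
        have hs : Real.sqrt ((R : ℝ) + 1) ≠ 0 := (Real.sqrt_pos.2 hR1).ne'
        have hss : Real.sqrt ((R : ℝ) + 1) * Real.sqrt ((R : ℝ) + 1) = (R : ℝ) + 1 :=
          Real.mul_self_sqrt hR1.le
        field_simp
        nlinarith [hss]


/-! ### Exact Fourier inversion for the square wave (used for the short periods) -/

/-- **Fourier inversion on one period**: for every `a ∈ ℤ` and `x ∈ ℤ`,
`g(x) = ∑_{i<q} ĝ(a+i) e((a+i)x/q)` (any `q` consecutive frequencies). [folklore] -/
theorem sqWave_eq_sum_sqCoeff {q : ℕ} (hq : 0 < q) (a x : ℤ) :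
    (sqWave q x : ℂ) = ∑ i ∈ range q, sqCoeff q (a + i) * (𝐞 ((((a + i : ℤ)) : ℝ) / q * x) : ℂ) := by
  have hq' : (q : ℂ) ≠ 0 := by exact_mod_cast hq.ne'
  have hqz : (0 : ℤ) < q := by exact_mod_cast hq
  -- expand the coefficients and swap the sums
  have h1 : ∑ i ∈ range q, sqCoeff q (a + i) * (𝐞 ((((a + i : ℤ)) : ℝ) / q * x) : ℂ) =
      (∑ y ∈ range q, (sqWave q y : ℂ) *
        ∑ i ∈ range q, (𝐞 ((((a + i : ℤ)) : ℝ) * ((x - y : ℤ)) / q) : ℂ)) / q := by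
    unfold sqCoeff
    simp_rw [div_mul_eq_mul_div, Finset.sum_mul]
    rw [← Finset.sum_div, Finset.sum_comm]
    congr 1
    refine Finset.sum_congr rfl fun y _ => ?_
    rw [Finset.mul_sum]
    refine Finset.sum_congr rfl fun i _ => ?_
    rw [mul_assoc, ← Circle.coe_mul, ← AddChar.map_add_eq_mul]
    congr 3
    push_cast; ring
  rw [h1]
  simp_rw [sum_range_fourierChar_div q hq]
  -- exactly one residue `y₀ = x mod q` contributes
  set y₀ : ℕ := (x % q).toNat with hy₀
  have hy₀' : (y₀ : ℤ) = x % q := Int.toNat_of_nonneg (Int.emod_nonneg _ hqz.ne')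
  have hy₀q : y₀ < q := by
    have : (y₀ : ℤ) < q := by rw [hy₀']; exact Int.emod_lt_of_pos _ hqz
    exact_mod_cast this
  have hdvd₀ : (q : ℤ) ∣ x - y₀ := by
    rw [hy₀', Int.emod_def]; exact ⟨x / q, by ring⟩
  rw [Finset.sum_eq_single_of_mem y₀ (Finset.mem_range.2 hy₀q)]
  · rw [if_pos hdvd₀, mul_div_assoc, div_self hq', mul_one]
    unfold sqWave
    rw [show ((y₀ : ℕ) : ℤ) % (q : ℤ) = x % q from by
      rw [hy₀']; exact Int.emod_emod_of_dvd _ (dvd_refl _)]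
  · intro y hy hne
    rw [Finset.mem_range] at hy
    rw [if_neg, mul_zero]
    rintro ⟨c, hc⟩
    apply hne
    have : (y : ℤ) = x % q := by
      have hx : x = y + q * c := by linarith
      rw [hx, Int.add_mul_emod_self_left, Int.emod_eq_of_lt (by positivity) (by exact_mod_cast hy)]
    have : (y : ℤ) = y₀ := by rw [this, hy₀']
    exact_mod_cast this

/-! ### Products of approximants: the abstract form of Kátai's argument -/

/-- If `|uᵢ|, |vᵢ| ≤ 1` then `|∏ uᵢ - ∏ vᵢ| ≤ ∑ |uᵢ - vᵢ|`. [folklore] -/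
theorem norm_prod_sub_prod_le {ι : Type*} (s : Finset ι) (u v : ι → ℂ)
    (hu : ∀ i ∈ s, ‖u i‖ ≤ 1) (hv : ∀ i ∈ s, ‖v i‖ ≤ 1) :
    ‖∏ i ∈ s, u i - ∏ i ∈ s, v i‖ ≤ ∑ i ∈ s, ‖u i - v i‖ := by
  classical
  induction s using Finset.induction with
  | empty => simp
  | insert a s ha ih =>
      have hu' : ∀ i ∈ s, ‖u i‖ ≤ 1 := fun i hi => hu i (Finset.mem_insert_of_mem hi)
      have hv' : ∀ i ∈ s, ‖v i‖ ≤ 1 := fun i hi => hv i (Finset.mem_insert_of_mem hi)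
      rw [Finset.prod_insert ha, Finset.prod_insert ha, Finset.sum_insert ha]
      have hpv : ‖∏ i ∈ s, v i‖ ≤ 1 := by
        refine (Finset.norm_prod_le _ _).trans ?_
        exact Finset.prod_le_one (fun i _ => norm_nonneg _) hv'
      calc ‖u a * ∏ i ∈ s, u i - v a * ∏ i ∈ s, v i‖
          = ‖u a * (∏ i ∈ s, u i - ∏ i ∈ s, v i) + (u a - v a) * ∏ i ∈ s, v i‖ := by ring_nf
        _ ≤ ‖u a‖ * ‖∏ i ∈ s, u i - ∏ i ∈ s, v i‖ + ‖u a - v a‖ * ‖∏ i ∈ s, v i‖ := by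
            refine (norm_add_le _ _).trans ?_
            rw [norm_mul, norm_mul]
        _ ≤ 1 * ∑ i ∈ s, ‖u i - v i‖ + ‖u a - v a‖ * 1 := by
            gcongr
            · exact hu a (Finset.mem_insert_self a s)
            · exact ih hu' hv'
        _ = ‖u a - v a‖ + ∑ i ∈ s, ‖u i - v i‖ := by ring

/-- `∏ⱼ e(cⱼ) = e(∑ⱼ cⱼ)`. [folklore] -/
theorem prod_fourierChar {ι : Type*} (s : Finset ι) (c : ι → ℝ) :
    ∏ j ∈ s, (𝐞 (c j) : ℂ) = (𝐞 (∑ j ∈ s, c j) : ℂ) := by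
  simp_rw [Real.fourierChar_apply]
  rw [← Complex.exp_sum]
  congr 1
  push_cast
  rw [Finset.mul_sum, Finset.sum_mul]

/-- **Replacing each factor by its approximant** costs at most the sum of the `L¹` errors:
if `|f|, |gⱼ|, |Pⱼ| ≤ 1` and `∑_{x<N} |gⱼ(x) - Pⱼ(x)| ≤ εN` for each `j ∈ S`, then
`|∑_{x<N} f(x) ∏ⱼ gⱼ(x) - ∑_{x<N} f(x) ∏ⱼ Pⱼ(x)| ≤ |S| ε N`.
[cite: Green2012, §3, proof of Proposition 2 ("Replacing each copy of ψ by ψ̃ in turn")] -/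
theorem norm_sum_mul_prod_sub_le {N : ℕ} (S : Finset ℕ) (f : ℕ → ℂ) (g P : ℕ → ℕ → ℂ) {ε : ℝ}
    (hf : ∀ x, ‖f x‖ ≤ 1) (hg : ∀ j ∈ S, ∀ x, ‖g j x‖ ≤ 1) (hP : ∀ j ∈ S, ∀ x, ‖P j x‖ ≤ 1)
    (herr : ∀ j ∈ S, ∑ x ∈ range N, ‖g j x - P j x‖ ≤ ε * N) :
    ‖∑ x ∈ range N, f x * ∏ j ∈ S, g j x - ∑ x ∈ range N, f x * ∏ j ∈ S, P j x‖ ≤ S.card * ε * N := by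
  rw [← Finset.sum_sub_distrib]
  calc ‖∑ x ∈ range N, (f x * ∏ j ∈ S, g j x - f x * ∏ j ∈ S, P j x)‖
      ≤ ∑ x ∈ range N, ‖f x * ∏ j ∈ S, g j x - f x * ∏ j ∈ S, P j x‖ := norm_sum_le _ _
    _ ≤ ∑ x ∈ range N, ∑ j ∈ S, ‖g j x - P j x‖ := by
        refine Finset.sum_le_sum fun x _ => ?_
        rw [← mul_sub, norm_mul]
        calc ‖f x‖ * ‖∏ j ∈ S, g j x - ∏ j ∈ S, P j x‖ ≤ 1 * ∑ j ∈ S, ‖g j x - P j x‖ :=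
              mul_le_mul (hf x) (norm_prod_sub_prod_le S _ _ (fun j hj => hg j hj x)
                (fun j hj => hP j hj x)) (norm_nonneg _) zero_le_one
          _ = ∑ j ∈ S, ‖g j x - P j x‖ := one_mul _
    _ = ∑ j ∈ S, ∑ x ∈ range N, ‖g j x - P j x‖ := Finset.sum_comm
    _ ≤ ∑ j ∈ S, ε * N := Finset.sum_le_sum herr
    _ = S.card * ε * N := by rw [Finset.sum_const, nsmul_eq_mul]; ring

/-- **Expanding the product of trigonometric polynomials**: with
`Pⱼ(x) = ∑_{p ∈ tⱼ} aⱼ(p) e(φⱼ(p) x)`,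
`∑_{x<N} f(x) ∏_{j∈S} Pⱼ(x) = ∑_{P ∈ ∏ⱼ tⱼ} (∏ⱼ aⱼ(Pⱼ)) · ∑_{x<N} f(x) e((∑ⱼ φⱼ(Pⱼ)) x)`.
[cite: Green2012, §3, proof of Proposition 2 ("Now develop each ψ̃ in its Fourier series")] -/
theorem sum_mul_prod_trigPoly_eq {κ : Type*} {N : ℕ} (S : Finset ℕ) (f : ℕ → ℂ)
    (t : ℕ → Finset κ) (a : ℕ → κ → ℂ) (φ : ℕ → κ → ℝ) :
    ∑ x ∈ range N, f x * ∏ j ∈ S, (∑ p ∈ t j, a j p * (𝐞 (φ j p * x) : ℂ)) =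
      ∑ P ∈ S.pi t, (∏ j ∈ S.attach, a j.1 (P j.1 j.2)) *
        ∑ x ∈ range N, f x * (𝐞 ((∑ j ∈ S.attach, φ j.1 (P j.1 j.2)) * x) : ℂ) := by
  classical
  have hexp : ∀ x : ℕ, ∏ j ∈ S, (∑ p ∈ t j, a j p * (𝐞 (φ j p * x) : ℂ)) =
      ∑ P ∈ S.pi t, (∏ j ∈ S.attach, a j.1 (P j.1 j.2)) *
        (𝐞 ((∑ j ∈ S.attach, φ j.1 (P j.1 j.2)) * x) : ℂ) := by
    intro x
    rw [Finset.prod_sum]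
    refine Finset.sum_congr rfl fun P _ => ?_
    rw [Finset.prod_mul_distrib, prod_fourierChar, Finset.sum_mul]
  simp_rw [hexp, Finset.mul_sum]
  rw [Finset.sum_comm]
  refine Finset.sum_congr rfl fun P _ => ?_
  refine Finset.sum_congr rfl fun x _ => ?_
  ring

/-- **Pigeonholing a large linear combination**: if `L ≤ |∑_{p∈U} c_p F_p|` and
`∑_{p∈U} |c_p| ≤ B` with `U` nonempty, then some `|F_p| ≥ L/B`. [folklore] -/
theorem exists_norm_ge_of_sum {κ : Type*} (U : Finset κ) (hU : U.Nonempty) (c F : κ → ℂ) {L B : ℝ}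
    (hB : 0 < B) (hL : L ≤ ‖∑ p ∈ U, c p * F p‖) (hc : ∑ p ∈ U, ‖c p‖ ≤ B) :
    ∃ p ∈ U, L / B ≤ ‖F p‖ := by
  obtain ⟨p₀, hp₀, hmax⟩ := Finset.exists_max_image U (fun p => ‖F p‖) hU
  refine ⟨p₀, hp₀, ?_⟩
  rw [div_le_iff₀ hB]
  calc L ≤ ‖∑ p ∈ U, c p * F p‖ := hL
    _ ≤ ∑ p ∈ U, ‖c p‖ * ‖F p‖ := (norm_sum_le _ _).trans (le_of_eq (by simp_rw [norm_mul]))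
    _ ≤ ∑ p ∈ U, ‖c p‖ * ‖F p₀‖ := Finset.sum_le_sum fun p hp =>
        mul_le_mul_of_nonneg_left (hmax p hp) (norm_nonneg _)
    _ = (∑ p ∈ U, ‖c p‖) * ‖F p₀‖ := by rw [Finset.sum_mul]
    _ ≤ B * ‖F p₀‖ := mul_le_mul_of_nonneg_right hc (norm_nonneg _)
    _ = ‖F p₀‖ * B := mul_comm _ _

/-- **Kátai's argument, abstract form** (Green 2012, proof of Proposition 2). Let `|f| ≤ 1`,
and for each level `j ∈ S` let `gⱼ` be bounded by `1` and approximated in `L¹` over `[0, N)`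
within `εN` by a trigonometric polynomial `Pⱼ(x) = ∑_{p∈tⱼ} aⱼ(p) e(φⱼ(p)x)` bounded by `1`, with
`∑_p |aⱼ(p)| ≤ B`. If `|∑_{x<N} f(x) ∏ⱼ gⱼ(x)| ≥ δN` and `|S| ε ≤ δ/2`, then for some choice of
one frequency `φⱼ(Pⱼ)` per level, `|∑_{x<N} f(x) e((∑ⱼ φⱼ(Pⱼ))x)| ≥ δN/(2B^{|S|})`.
[cite: Green2012, §3, Proposition 2 (proof)] -/
theorem exists_pi_of_large_correlation {κ : Type*} {N : ℕ} (S : Finset ℕ) (f : ℕ → ℂ)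
    (g : ℕ → ℕ → ℂ) (t : ℕ → Finset κ) (a : ℕ → κ → ℂ) (φ : ℕ → κ → ℝ) {ε δ B : ℝ}
    (hf : ∀ x, ‖f x‖ ≤ 1) (hg : ∀ j ∈ S, ∀ x, ‖g j x‖ ≤ 1)
    (hP : ∀ j ∈ S, ∀ x : ℕ, ‖∑ p ∈ t j, a j p * (𝐞 (φ j p * x) : ℂ)‖ ≤ 1)
    (herr : ∀ j ∈ S, ∑ x ∈ range N, ‖g j x - ∑ p ∈ t j, a j p * (𝐞 (φ j p * x) : ℂ)‖ ≤ ε * N)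
    (ht : ∀ j ∈ S, (t j).Nonempty) (hB : 0 < B) (ha : ∀ j ∈ S, ∑ p ∈ t j, ‖a j p‖ ≤ B)
    (hmain : δ * N ≤ ‖∑ x ∈ range N, f x * ∏ j ∈ S, g j x‖) (hε : S.card * ε ≤ δ / 2) :
    ∃ P ∈ S.pi t, δ * N / (2 * B ^ S.card) ≤
      ‖∑ x ∈ range N, f x * (𝐞 ((∑ j ∈ S.attach, φ j.1 (P j.1 j.2)) * x) : ℂ)‖ := by
  classical
  set Papprox : ℕ → ℕ → ℂ := fun j x => ∑ p ∈ t j, a j p * (𝐞 (φ j p * x) : ℂ) with hPa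
  have h1 := norm_sum_mul_prod_sub_le S f g Papprox hf hg hP herr
  have h2 : δ * N / 2 ≤ ‖∑ x ∈ range N, f x * ∏ j ∈ S, Papprox j x‖ := by
    have hN : (0 : ℝ) ≤ N := Nat.cast_nonneg N
    have : (S.card : ℝ) * ε * N ≤ δ / 2 * N := mul_le_mul_of_nonneg_right hε hN
    have := norm_le_norm_add_norm_sub' (∑ x ∈ range N, f x * ∏ j ∈ S, g j x)
      (∑ x ∈ range N, f x * ∏ j ∈ S, Papprox j x)
    linarith
  have hexp := sum_mul_prod_trigPoly_eq (N := N) S f t a φ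
  simp only [hPa] at h2
  rw [hexp] at h2
  have hU : (S.pi t).Nonempty := Finset.pi_nonempty.2 ht
  have hBk : 0 < B ^ S.card := pow_pos hB _
  have hc : ∑ P ∈ S.pi t, ‖∏ j ∈ S.attach, a j.1 (P j.1 j.2)‖ ≤ B ^ S.card := by
    calc ∑ P ∈ S.pi t, ‖∏ j ∈ S.attach, a j.1 (P j.1 j.2)‖
        ≤ ∑ P ∈ S.pi t, ∏ j ∈ S.attach, ‖a j.1 (P j.1 j.2)‖ :=
          Finset.sum_le_sum fun P _ => Finset.norm_prod_le _ _
      _ = ∏ j ∈ S, ∑ p ∈ t j, ‖a j p‖ := by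
          rw [Finset.prod_sum]
      _ ≤ ∏ j ∈ S, B := Finset.prod_le_prod (fun j _ => Finset.sum_nonneg fun _ _ => norm_nonneg _) ha
      _ = B ^ S.card := Finset.prod_const B
  obtain ⟨P, hPU, hPge⟩ := exists_norm_ge_of_sum (S.pi t) hU _ _ hBk h2 hc
  refine ⟨P, hPU, ?_⟩
  rw [show δ * N / (2 * B ^ S.card) = δ * N / 2 / B ^ S.card by rw [div_div]]
  exact hPge


/-! ### The levels: binary digits as square waves, and their approximants -/

/-- The frequency attached to an index `p = (i, s)` at level `j` (period `q = 2^{j+1}`): for a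
short period (`q < 2(R+1)`, exact inversion) it is `i + 1 - q/2 ∈ (-q/2, q/2]`, for a long period
(Fejér smoothing) it is `s - i`. [folklore] -/
def levelFreq (R j : ℕ) (p : ℕ × ℕ) : ℤ :=
  if 2 ^ (j + 1) < 2 * (R + 1) then 1 - ((2 ^ (j + 1) / 2 : ℕ) : ℤ) + p.1 else (p.2 : ℤ) - p.1

/-- The index set at level `j`: `range q × {0}` (short period) or `range (R+1) × range (R+1)`
(long period). [folklore] -/
def levelSet (R j : ℕ) : Finset (ℕ × ℕ) :=
  if 2 ^ (j + 1) < 2 * (R + 1) then range (2 ^ (j + 1)) ×ˢ {0} else range (R + 1) ×ˢ range (R + 1)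

/-- The coefficient attached to an index at level `j`: `ĝ(freq)` (short period) or
`ĝ(freq)/(R+1)` (long period). [folklore] -/
def levelCoeff (R j : ℕ) (p : ℕ × ℕ) : ℂ :=
  (if 2 ^ (j + 1) < 2 * (R + 1) then (1 : ℂ) else 1 / ((R : ℂ) + 1)) *
    sqCoeff (2 ^ (j + 1)) (levelFreq R j p)

/-- The phase `freq / 2^{j+1}` attached to an index at level `j`. [folklore] -/
def levelPhase (R j : ℕ) (p : ℕ × ℕ) : ℝ := (levelFreq R j p : ℝ) / (2 ^ (j + 1) : ℕ)

/-- The approximant of the digit sign `(-1)^{x_j}` at level `j`: a trigonometric polynomial with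
frequencies `freq/2^{j+1}`, `|freq| ≤ R`. [folklore] -/
def levelPoly (R j : ℕ) (x : ℕ) : ℂ :=
  ∑ p ∈ levelSet R j, levelCoeff R j p * (𝐞 (levelPhase R j p * x) : ℂ)

/-- The index sets are nonempty. [folklore] -/
theorem levelSet_nonempty (R j : ℕ) : (levelSet R j).Nonempty := by
  unfold levelSet
  split_ifs
  · exact Finset.Nonempty.product ⟨0, by simp⟩ (by simp)
  · exact Finset.Nonempty.product ⟨0, by simp⟩ ⟨0, by simp⟩

/-- All frequencies at level `j` are at most `R` in absolute value. [folklore] -/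
theorem abs_levelFreq_le {R j : ℕ} {p : ℕ × ℕ} (hp : p ∈ levelSet R j) :
    |levelFreq R j p| ≤ R := by
  unfold levelSet at hp
  unfold levelFreq
  have hq2 : (2 ^ (j + 1) / 2 : ℕ) = 2 ^ j := by rw [pow_succ, Nat.mul_div_cancel _ Nat.two_pos]
  split_ifs at hp ⊢ with hsmall
  · rw [Finset.mem_product, Finset.mem_range] at hp
    rw [hq2]
    have h1 : 2 ^ j ≤ R := by
      have : 2 ^ (j + 1) = 2 * 2 ^ j := by ring
      omega
    have h2 : p.1 < 2 * 2 ^ j := by rw [← pow_succ']; exact hp.1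
    rw [abs_le]
    constructor
    · have : ((2 ^ j : ℕ) : ℤ) ≤ R := by exact_mod_cast h1
      push_cast at this ⊢
      linarith
    · have : (p.1 : ℤ) < 2 * 2 ^ j := by exact_mod_cast h2
      have h1' : ((2 ^ j : ℕ) : ℤ) ≤ R := by exact_mod_cast h1
      push_cast at h1' ⊢
      linarith
  · rw [Finset.mem_product, Finset.mem_range, Finset.mem_range] at hp
    rw [abs_le]
    constructor <;> omega

/-- The coefficient mass at each level is at most `2R + 1`. [folklore] -/
theorem sum_norm_levelCoeff_le (R j : ℕ) :
    ∑ p ∈ levelSet R j, ‖levelCoeff R j p‖ ≤ 2 * R + 1 := by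
  unfold levelSet levelCoeff
  split_ifs with hsmall
  · calc ∑ p ∈ range (2 ^ (j + 1)) ×ˢ ({0} : Finset ℕ), ‖(1 : ℂ) * sqCoeff (2 ^ (j + 1)) (levelFreq R j p)‖
        ≤ ∑ p ∈ range (2 ^ (j + 1)) ×ˢ ({0} : Finset ℕ), (1 : ℝ) := by
          refine Finset.sum_le_sum fun p _ => ?_
          rw [one_mul]; exact norm_sqCoeff_le_one _ _
      _ = 2 ^ (j + 1) := by simp
      _ ≤ 2 * R + 1 := by exact_mod_cast (by omega : 2 ^ (j + 1) ≤ 2 * R + 1)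
  · have hR : (0 : ℝ) < (R : ℝ) + 1 := by positivity
    calc ∑ p ∈ range (R + 1) ×ˢ range (R + 1), ‖1 / ((R : ℂ) + 1) * sqCoeff (2 ^ (j + 1)) (levelFreq R j p)‖
        ≤ ∑ p ∈ range (R + 1) ×ˢ range (R + 1), 1 / ((R : ℝ) + 1) := by
          refine Finset.sum_le_sum fun p _ => ?_
          rw [norm_mul, norm_div, norm_one, show ((R : ℂ) + 1) = (((R : ℝ) + 1 : ℝ) : ℂ) by push_cast; ring,
            Complex.norm_real, Real.norm_eq_abs, abs_of_pos hR]
          exact mul_le_of_le_one_right (by positivity) (norm_sqCoeff_le_one _ _)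
      _ = (R + 1) := by
          rw [Finset.sum_const, Finset.card_product, Finset.card_range, nsmul_eq_mul]
          push_cast
          field_simp
      _ ≤ 2 * R + 1 := by linarith [(Nat.cast_nonneg R : (0 : ℝ) ≤ R)]

/-- Short periods: the level polynomial IS the digit sign (exact inversion). [folklore] -/
theorem levelPoly_eq_sqWave {R j : ℕ} (hsmall : 2 ^ (j + 1) < 2 * (R + 1)) (x : ℕ) :
    levelPoly R j x = (sqWave (2 ^ (j + 1)) x : ℂ) := by
  unfold levelPoly levelCoeff levelPhase levelSet levelFreq
  simp only [if_pos hsmall, one_mul]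
  rw [Finset.sum_product]
  simp only [Finset.sum_singleton]
  rw [sqWave_eq_sum_sqCoeff (Nat.two_pow_pos _) (1 - ((2 ^ (j + 1) / 2 : ℕ) : ℤ)) (x : ℤ)]
  simp only [Int.cast_natCast]

/-- Long periods: the level polynomial is the Fejér smoothing of the digit sign. [folklore] -/
theorem levelPoly_eq_fejerApprox {R j : ℕ} (hlarge : ¬ 2 ^ (j + 1) < 2 * (R + 1)) (x : ℕ) :
    levelPoly R j x = fejerApprox (2 ^ (j + 1)) R x := by
  unfold levelPoly levelCoeff levelPhase levelSet levelFreq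
  simp only [if_neg hlarge]
  rw [fejerApprox_eq_sum (Nat.two_pow_pos _)]
  refine Finset.sum_congr rfl fun p _ => ?_
  push_cast
  ring_nf

/-- The level polynomials are bounded by `1`. [folklore] -/
theorem norm_levelPoly_le_one (R j x : ℕ) : ‖levelPoly R j x‖ ≤ 1 := by
  by_cases hsmall : 2 ^ (j + 1) < 2 * (R + 1)
  · rw [levelPoly_eq_sqWave hsmall, norm_sqWave]
  · rw [levelPoly_eq_fejerApprox hsmall]
    exact norm_fejerApprox_le_one (by omega) _

/-- **The `L¹` error at level `j < n` over `[0, 2ⁿ)`** is at most `4 · 2ⁿ/√(R+1)`. [folklore] -/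
theorem sum_norm_sqWave_sub_levelPoly_le {R j n : ℕ} (hjn : j < n) :
    ∑ x ∈ range (2 ^ n), ‖(sqWave (2 ^ (j + 1)) x : ℂ) - levelPoly R j x‖ ≤
      4 * (2 : ℝ) ^ n / Real.sqrt (R + 1) := by
  by_cases hsmall : 2 ^ (j + 1) < 2 * (R + 1)
  · simp_rw [levelPoly_eq_sqWave hsmall, sub_self, norm_zero, Finset.sum_const_zero]
    positivity
  · simp_rw [levelPoly_eq_fejerApprox hsmall]
    set q : ℕ := 2 ^ (j + 1) with hq
    have hqpos : 0 < q := Nat.two_pow_pos _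
    have hN : 2 ^ n = q * 2 ^ (n - j - 1) := by
      rw [hq, ← pow_add]; congr 1; omega
    have hper : ∀ y : ℤ, (fun y : ℤ => ‖(sqWave q y : ℂ) - fejerApprox q R y‖) (y + q) =
        (fun y : ℤ => ‖(sqWave q y : ℂ) - fejerApprox q R y‖) y := by
      intro y
      simp only [sqWave_add_period, fejerApprox_add_period]
    have h := sum_range_mul_eq_of_periodic (fun y : ℤ => ‖(sqWave q y : ℂ) - fejerApprox q R y‖) q hper
      (2 ^ (n - j - 1))
    rw [hN, h, nsmul_eq_mul]
    have hE := sum_norm_sqWave_sub_fejerApprox_le (q := q) (R := R) ⟨2 ^ j, by rw [hq]; ring⟩ (by omega)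
    calc ((2 ^ (n - j - 1) : ℕ) : ℝ) * ∑ i ∈ range q, ‖(sqWave q i : ℂ) - fejerApprox q R i‖
        ≤ ((2 ^ (n - j - 1) : ℕ) : ℝ) * (4 * q / Real.sqrt (R + 1)) := by gcongr
      _ = 4 * ((q * 2 ^ (n - j - 1) : ℕ) : ℝ) / Real.sqrt (R + 1) := by push_cast; ring
      _ = 4 * (2 : ℝ) ^ n / Real.sqrt (R + 1) := by rw [← hN]; push_cast; ring

/-! ### Green's Proposition 2 -/

/-- The size of the numerators in Green's Proposition 2 (this file's constants):
`R(k, δ) = ⌈64k²/δ²⌉`. [cite: Green2012, Proposition 2] -/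
def kataiR (k : ℕ) (δ : ℝ) : ℕ := ⌈64 * (k : ℝ) ^ 2 / δ ^ 2⌉₊

/-- The sign `(-1)^{x_j}` of the binary digit of weight `2^j` of `x`. [folklore] -/
def bitSign (j x : ℕ) : ℝ := if x.testBit j then -1 else 1

/-- `bitSign j x` is the square wave of period `2^{j+1}`. [folklore] -/
theorem bitSign_eq_sqWave (j x : ℕ) : bitSign j x = sqWave (2 ^ (j + 1)) x := by
  rw [sqWave_two_pow_eq]; rfl

/-- **Green 2012, Proposition 2 (Kátai's argument)**, explicit form with this file's constants.
Let `N = 2ⁿ`, `f : ℕ → ℝ` with `|f| ≤ 1`, `S ⊆ {0, …, n-1}` nonempty with `|S| = k`, and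
suppose the Fourier–Walsh sum is large: `|∑_{x<N} f(x) ∏_{j∈S} (-1)^{x_j}| ≥ δN`, `δ > 0`.
Then there are integers `r_j`, `|r_j| ≤ R := ⌈64k²/δ²⌉`, such that the exponential sum at the
sparse dyadic rational `θ = ∑_{j∈S} r_j/2^{j+1}` is large:
`|∑_{x<N} f(x) e(θx)| ≥ δN / (2(2R+1)^k)`.
(Printed: `|r_i| ≤ (10k/δ)³` and `|f̂(θ)| ≥ (δ/10k)^{4k}`, digits indexed by `{1,…,n}` with
weight `2^{i-1}`; the constants here come from a discrete Fejér smoothing of the digit functions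
in place of the paper's `φ ∗ χ ∗ χ`, and the digit of weight `2^j` is Green's digit `i = j+1`.)
[cite: Green2012, Proposition 2] -/
theorem exists_sparseDyadic_of_large_walsh {n : ℕ} (f : ℕ → ℝ) (hf : ∀ x, |f x| ≤ 1)
    (S : Finset ℕ) (hS : S.Nonempty) (hSn : ∀ j ∈ S, j < n) {δ : ℝ} (hδ : 0 < δ)
    (hW : δ * 2 ^ n ≤ |∑ x ∈ range (2 ^ n), f x * ∏ j ∈ S, bitSign j x|) :
    ∃ r : ℕ → ℤ, (∀ j ∈ S, |r j| ≤ kataiR S.card δ) ∧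
      δ * 2 ^ n / (2 * (2 * kataiR S.card δ + 1) ^ S.card) ≤
        ‖∑ x ∈ range (2 ^ n), (f x : ℂ) * (𝐞 ((∑ j ∈ S, (r j : ℝ) / 2 ^ (j + 1)) * x) : ℂ)‖ := by
  classical
  set k : ℕ := S.card with hk
  have hk1 : 1 ≤ k := Finset.card_pos.2 hS
  have hk0 : (0 : ℝ) < k := by exact_mod_cast hk1
  set R : ℕ := kataiR k δ with hR
  have hRge : 64 * (k : ℝ) ^ 2 / δ ^ 2 ≤ R := Nat.le_ceil _
  have hR1 : (0 : ℝ) < (R : ℝ) + 1 := by positivity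
  -- the `L¹` budget
  have hsqrt : 8 * k / δ ≤ Real.sqrt (R + 1) := by
    rw [show 8 * (k : ℝ) / δ = Real.sqrt ((8 * k / δ) ^ 2) by
      rw [Real.sqrt_sq (by positivity)]]
    exact Real.sqrt_le_sqrt (by
      have : (8 * (k : ℝ) / δ) ^ 2 = 64 * (k : ℝ) ^ 2 / δ ^ 2 := by ring
      rw [this]; linarith)
  have hε : (S.card : ℝ) * (4 / Real.sqrt (R + 1)) ≤ δ / 2 := by
    rw [← hk]
    have hs : 0 < Real.sqrt ((R : ℝ) + 1) := Real.sqrt_pos.2 hR1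
    rw [mul_div_assoc', div_le_iff₀ hs]
    calc (k : ℝ) * 4 = δ / 2 * (8 * k / δ) := by field_simp; ring
      _ ≤ δ / 2 * Real.sqrt (R + 1) := by gcongr
  -- apply the abstract argument
  have hmain : δ * ((2 ^ n : ℕ) : ℝ) ≤
      ‖∑ x ∈ range (2 ^ n), (f x : ℂ) * ∏ j ∈ S, (sqWave (2 ^ (j + 1)) x : ℂ)‖ := by
    have hcast : ∑ x ∈ range (2 ^ n), (f x : ℂ) * ∏ j ∈ S, (sqWave (2 ^ (j + 1)) x : ℂ) =
        ((∑ x ∈ range (2 ^ n), f x * ∏ j ∈ S, bitSign j x : ℝ) : ℂ) := by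
      push_cast
      simp_rw [bitSign_eq_sqWave]
    rw [hcast, Complex.norm_real, Real.norm_eq_abs]
    exact_mod_cast hW
  obtain ⟨P, hP, hge⟩ := exists_pi_of_large_correlation (N := 2 ^ n) S (fun x => (f x : ℂ))
    (fun j x => (sqWave (2 ^ (j + 1)) x : ℂ)) (levelSet R) (levelCoeff R) (levelPhase R)
    (ε := 4 / Real.sqrt (R + 1)) (δ := δ) (B := 2 * R + 1)
    (fun x => by rw [Complex.norm_real, Real.norm_eq_abs]; exact hf x)
    (fun j _ x => by rw [norm_sqWave])
    (fun j _ x => norm_levelPoly_le_one R j x)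
    (fun j hj => by
      have h := sum_norm_sqWave_sub_levelPoly_le (R := R) (hSn j hj)
      unfold levelPoly at h
      push_cast
      refine h.trans_eq ?_
      ring)
    (fun j _ => levelSet_nonempty R j) (by positivity) (fun j _ => sum_norm_levelCoeff_le R j) hmain hε
  -- read off the frequencies
  refine ⟨fun j => if h : j ∈ S then levelFreq R j (P j h) else 0, fun j hj => ?_, ?_⟩
  · simp only [dif_pos hj]
    exact abs_levelFreq_le ((Finset.mem_pi.1 hP) j hj)
  · beta_reduce
    have hθ : (∑ j ∈ S, (((if h : j ∈ S then levelFreq R j (P j h) else 0 : ℤ)) : ℝ) / 2 ^ (j + 1)) =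
        ∑ j ∈ S.attach, levelPhase R j.1 (P j.1 j.2) := by
      rw [← Finset.sum_attach S]
      refine Finset.sum_congr rfl fun j _ => ?_
      rw [dif_pos j.2, levelPhase]
      push_cast
      rfl
    rw [hθ]
    push_cast at hge
    exact hge


/-- **Green 2012, Proposition 2 in the tree's Walsh vocabulary** (`walshSum` of
`Literature/NumberTheory/LFunctions/MoebiusWalshCircuits.lean`, digits `Fin n`, `g : ℕ → ℤ` with
`|g| ≤ 1` — e.g. `μ` or `λ`): if `|walshSum g S| ≥ δ 2ⁿ` with `δ > 0`, `S ≠ ∅`, then for some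
integers `|r_j| ≤ R = ⌈64|S|²/δ²⌉` (`j ∈ S`),
`|∑_{x<2ⁿ} g(x) e(θx)| ≥ δ2ⁿ/(2(2R+1)^{|S|})` at `θ = ∑_{j∈S} r_j/2^{j+1}`.
[cite: Green2012, Proposition 2] -/
theorem exists_sparseDyadic_of_large_walshSum {n : ℕ} (g : ℕ → ℤ) (hg : ∀ m, |g m| ≤ 1)
    (S : Finset (Fin n)) (hS : S.Nonempty) {δ : ℝ} (hδ : 0 < δ)
    (hW : δ * 2 ^ n ≤ |walshSum g S|) :
    ∃ r : ℕ → ℤ, (∀ j ∈ S, |r j| ≤ kataiR S.card δ) ∧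
      δ * 2 ^ n / (2 * (2 * kataiR S.card δ + 1) ^ S.card) ≤
        ‖∑ x ∈ range (2 ^ n), (g x : ℂ) * (𝐞 ((∑ j ∈ S, (r j : ℝ) / 2 ^ ((j : ℕ) + 1)) * x) : ℂ)‖ := by
  set S' : Finset ℕ := S.map Fin.valEmbedding with hS'
  have hcard : S'.card = S.card := Finset.card_map _
  have hS'n : ∀ j ∈ S', j < n := by
    intro j hj
    rw [hS', Finset.mem_map] at hj
    obtain ⟨i, _, rfl⟩ := hj
    exact i.isLt
  have hW' : δ * 2 ^ n ≤ |∑ x ∈ range (2 ^ n), (g x : ℝ) * ∏ j ∈ S', bitSign j x| := by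
    have hWS : walshSum g S = ∑ x ∈ range (2 ^ n), (g x : ℝ) * ∏ j ∈ S', bitSign j x := by
      rw [Literature.NumberTheory.Sieve.MoebiusWalsh.walshSum_eq_sum_range]
      refine Finset.sum_congr rfl fun x _ => ?_
      congr 1
      rw [hS', Finset.prod_map]
      rfl
    rwa [hWS] at hW
  obtain ⟨r, hr, hge⟩ := exists_sparseDyadic_of_large_walsh (fun m => (g m : ℝ))
    (fun m => by exact_mod_cast hg m) S' ((Finset.map_nonempty).2 hS) hS'n hδ hW'
  refine ⟨r, fun j hj => ?_, ?_⟩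
  · rw [← hcard]
    exact hr j (by rw [hS']; exact Finset.mem_map_of_mem _ hj)
  · rw [← hcard]
    have hθ : ∑ j ∈ S, (r j : ℝ) / 2 ^ ((j : ℕ) + 1) = ∑ j ∈ S', (r j : ℝ) / 2 ^ (j + 1) := by
      rw [hS', Finset.sum_map]; rfl
    rw [hθ]
    push_cast at hge
    exact hge

/-! ### The Harman–Kátai lemma (Green 2012, Lemma 1) -/

/-- A gap of length `g` in a finite set of naturals below `n`: if `|S| g ≤ n/2`-ish, precisely if
`S` has `k ≥ 1` elements and `g = n/(2k)`, there is `m ≤ n - g` with no element of `S` in the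
open interval `(m, m + g)`. (Counting: each `i ∈ S` forbids fewer than `g` values of `m`.)
[folklore] -/
theorem exists_gap {n : ℕ} (S : Finset ℕ) (hS : S.Nonempty) {g : ℝ} (hg0 : 0 < g)
    (hg : 2 * S.card * g ≤ n) :
    ∃ m : ℕ, (m : ℝ) + g ≤ n ∧ ∀ i ∈ S, m < i → (m : ℝ) + g ≤ i := by
  classical
  have hk1 : 1 ≤ S.card := Finset.card_pos.2 hS
  have hk : (1 : ℝ) ≤ S.card := by exact_mod_cast hk1
  have hgn : g ≤ (n : ℝ) / 2 := by nlinarith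
  set c : ℕ := ⌈g⌉₊ with hc
  have hc1 : 1 ≤ c := Nat.one_le_iff_ne_zero.2 (by rw [hc]; exact Nat.ceil_pos.2 hg0 |>.ne')
  have hcg : (c : ℝ) < g + 1 := Nat.ceil_lt_add_one hg0.le
  have hgc : g ≤ c := Nat.le_ceil g
  -- bad values of `m`
  set B : Finset ℕ := S.biUnion (fun i => (range i).filter (fun m : ℕ => (i : ℝ) < (m : ℝ) + g)) with hB
  have hBi : ∀ i ∈ S, ((range i).filter (fun m : ℕ => (i : ℝ) < (m : ℝ) + g)).card ≤ c - 1 := by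
    intro i _
    calc ((range i).filter (fun m : ℕ => (i : ℝ) < (m : ℝ) + g)).card ≤ (Ico (i - (c - 1)) i).card := by
          refine Finset.card_le_card fun m hm => ?_
          rw [Finset.mem_filter, Finset.mem_range] at hm
          rw [Finset.mem_Ico]
          refine ⟨?_, hm.1⟩
          have h1 : (i : ℝ) < m + c := by linarith [hm.2]
          have h2 : i < m + c := by exact_mod_cast h1
          omega
      _ ≤ c - 1 := by rw [Nat.card_Ico]; omega
  have hBcard : (B.card : ℝ) ≤ (n : ℝ) / 2 := by
    have h1 : B.card ≤ S.card * (c - 1) := by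
      calc B.card ≤ ∑ i ∈ S, ((range i).filter (fun m : ℕ => (i : ℝ) < (m : ℝ) + g)).card := Finset.card_biUnion_le
        _ ≤ ∑ i ∈ S, (c - 1) := Finset.sum_le_sum hBi
        _ = S.card * (c - 1) := by rw [Finset.sum_const, smul_eq_mul]
    have h2 : ((c - 1 : ℕ) : ℝ) ≤ g := by push_cast [hc1]; linarith
    calc (B.card : ℝ) ≤ S.card * ((c - 1 : ℕ) : ℝ) := by exact_mod_cast h1
      _ ≤ S.card * g := by gcongr
      _ ≤ (n : ℝ) / 2 := by linarith
  -- candidates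
  set C : Finset ℕ := range (⌊(n : ℝ) - g⌋₊ + 1) with hC
  have hCcard : (n : ℝ) / 2 < C.card := by
    rw [hC, Finset.card_range]
    push_cast
    have := Nat.lt_floor_add_one ((n : ℝ) - g)
    linarith
  have hlt : B.card < C.card := by
    have : (B.card : ℝ) < C.card := by linarith
    exact_mod_cast this
  obtain ⟨m, hmC, hmB⟩ := Finset.exists_mem_notMem_of_card_lt_card hlt
  refine ⟨m, ?_, fun i hi hmi => ?_⟩
  · rw [hC, Finset.mem_range] at hmC
    have : (m : ℝ) ≤ ⌊(n : ℝ) - g⌋₊ := by exact_mod_cast Nat.lt_succ_iff.1 hmC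
    have hfl : (⌊(n : ℝ) - g⌋₊ : ℝ) ≤ (n : ℝ) - g := Nat.floor_le (by linarith)
    linarith
  · by_contra hcon
    apply hmB
    rw [hB, Finset.mem_biUnion]
    exact ⟨i, hi, Finset.mem_filter.2 ⟨Finset.mem_range.2 hmi, by linarith⟩⟩

/-- **Green 2012, Lemma 1 (Harman–Kátai)**. "Suppose that `θ = r₁/2^{i₁} + ⋯ + r_k/2^{i_k}`,
where `i₁ < ⋯ < i_k ≤ n` and `|r_i| ≤ Q` for all `i`. Suppose furthermore that there is some
`q ≤ Q` and an `a` coprime to `q` such that `|θ - a/q| ≤ Q/N`, and that we have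
`2^{n/2k} > 4Q²`. Then `q` is a power of two." Here `N = 2ⁿ`, the exponents form the finite
set `S ⊆ {0, …, n}` with `k = |S|`, and the gap in the exponents is found by counting
(`exists_gap`) instead of sorting. [cite: Green2012, Lemma 1] -/
theorem exists_eq_two_pow_of_near_sparseDyadic {n : ℕ} (S : Finset ℕ) (hS : S.Nonempty)
    (hSn : ∀ i ∈ S, i ≤ n) (r : ℕ → ℤ) {Q : ℝ} (hr : ∀ i ∈ S, |(r i : ℝ)| ≤ Q) {q : ℕ}
    (hq : 1 ≤ q) (hqQ : (q : ℝ) ≤ Q) {a : ℤ} (hcop : IsCoprime a (q : ℤ))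
    (hnear : |∑ i ∈ S, (r i : ℝ) / 2 ^ i - a / q| ≤ Q / 2 ^ n)
    (hgap : 4 * Q ^ 2 < (2 : ℝ) ^ ((n : ℝ) / (2 * S.card))) :
    ∃ e : ℕ, q = 2 ^ e := by
  classical
  set k : ℕ := S.card with hk
  have hk1 : 1 ≤ k := Finset.card_pos.2 hS
  have hk0 : (0 : ℝ) < k := by exact_mod_cast hk1
  have hq0 : (0 : ℝ) < q := by exact_mod_cast hq
  have hQ1 : (1 : ℝ) ≤ Q := le_trans (by exact_mod_cast hq) hqQ
  have hQ0 : 0 < Q := by linarith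
  -- `n ≥ 1` (otherwise `4Q² < 1`)
  have hn : 1 ≤ n := by
    by_contra h0
    have : n = 0 := by omega
    rw [this] at hgap
    simp only [CharP.cast_eq_zero, zero_div, Real.rpow_zero] at hgap
    nlinarith
  set g : ℝ := (n : ℝ) / (2 * k) with hgdef
  have hg0 : 0 < g := by positivity
  have hgk : 2 * (S.card : ℝ) * g = n := by rw [← hk, hgdef]; field_simp
  obtain ⟨m, hmn, hgapS⟩ := exists_gap S hS hg0 hgk.le
  -- the two powers of two
  have h2g : (2 : ℝ) ^ (-g) < 1 / (4 * Q ^ 2) := by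
    have hpos : (0 : ℝ) < (2 : ℝ) ^ g := Real.rpow_pos_of_pos two_pos g
    rw [Real.rpow_neg two_pos.le, ← one_div, one_div_lt_one_div hpos (by positivity)]
    rw [hgdef]; exact hgap
  -- split `θ` at `m`
  set A : ℤ := ∑ i ∈ S.filter (fun i => i ≤ m), r i * 2 ^ (m - i) with hA
  have hsplit : ∑ i ∈ S, (r i : ℝ) / 2 ^ i =
      (A : ℝ) / 2 ^ m + ∑ i ∈ S.filter (fun i => ¬ i ≤ m), (r i : ℝ) / 2 ^ i := by
    rw [← Finset.sum_filter_add_sum_filter_not S (fun i => i ≤ m)]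
    congr 1
    rw [hA]; push_cast
    rw [Finset.sum_div]
    refine Finset.sum_congr rfl fun i hi => ?_
    rw [Finset.mem_filter] at hi
    rw [pow_sub₀ (2 : ℝ) two_ne_zero hi.2]
    field_simp
  -- the tail is tiny
  have htail : |∑ i ∈ S.filter (fun i => ¬ i ≤ m), (r i : ℝ) / 2 ^ i| ≤
      2 * Q * ((2 : ℝ) ^ m)⁻¹ * (2 : ℝ) ^ (-g) := by
    set h₀ : ℕ := ⌈(m : ℝ) + g⌉₊ with hh₀
    have hsub : S.filter (fun i => ¬ i ≤ m) ⊆ Ico h₀ (n + 1) := by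
      intro i hi
      rw [Finset.mem_filter] at hi
      rw [Finset.mem_Ico]
      refine ⟨?_, Nat.lt_succ_of_le (hSn i hi.1)⟩
      rw [hh₀]
      exact Nat.ceil_le.2 (hgapS i hi.1 (by omega))
    calc |∑ i ∈ S.filter (fun i => ¬ i ≤ m), (r i : ℝ) / 2 ^ i|
        ≤ ∑ i ∈ S.filter (fun i => ¬ i ≤ m), |(r i : ℝ) / 2 ^ i| := Finset.abs_sum_le_sum_abs _ _
      _ ≤ ∑ i ∈ S.filter (fun i => ¬ i ≤ m), Q * (1 / 2) ^ i := by
          refine Finset.sum_le_sum fun i hi => ?_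
          rw [abs_div, abs_of_pos (by positivity : (0 : ℝ) < 2 ^ i), one_div, inv_pow, ← div_eq_mul_inv]
          exact div_le_div_of_nonneg_right (hr i (Finset.mem_filter.1 hi).1) (by positivity)
      _ ≤ ∑ i ∈ Ico h₀ (n + 1), Q * (1 / 2) ^ i :=
          Finset.sum_le_sum_of_subset_of_nonneg hsub fun i _ _ => by positivity
      _ = Q * ((1 / 2) ^ h₀ * ∑ l ∈ range (n + 1 - h₀), (1 / 2 : ℝ) ^ l) := by
          rw [← Finset.mul_sum, Finset.sum_Ico_eq_sum_range]
          congr 1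
          rw [Finset.mul_sum]
          refine Finset.sum_congr rfl fun l _ => ?_
          rw [pow_add]
      _ ≤ Q * ((1 / 2) ^ h₀ * 2) := by
          gcongr
          exact sum_geometric_two_le _
      _ = 2 * Q * (2 : ℝ) ^ (-(h₀ : ℝ)) := by
          rw [Real.rpow_neg two_pos.le, Real.rpow_natCast, one_div, inv_pow]; ring
      _ ≤ 2 * Q * (2 : ℝ) ^ (-((m : ℝ) + g)) := by
          gcongr
          · norm_num
          · rw [hh₀]; exact Nat.le_ceil _
      _ = 2 * Q * ((2 : ℝ) ^ m)⁻¹ * (2 : ℝ) ^ (-g) := by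
          rw [neg_add, Real.rpow_add two_pos, Real.rpow_neg two_pos.le, Real.rpow_natCast]; ring
  -- `2^m ≤ 2^n 2^{-g}`
  have hm2 : ((2 : ℝ) ^ n)⁻¹ ≤ ((2 : ℝ) ^ m)⁻¹ * (2 : ℝ) ^ (-g) := by
    have h1 : (2 : ℝ) ^ ((m : ℝ) + g) ≤ (2 : ℝ) ^ (n : ℝ) :=
      Real.rpow_le_rpow_of_exponent_le one_le_two hmn
    rw [Real.rpow_natCast, Real.rpow_add two_pos, Real.rpow_natCast] at h1
    have h2m : (0 : ℝ) < 2 ^ m := by positivity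
    have h2g' : (0 : ℝ) < (2 : ℝ) ^ g := Real.rpow_pos_of_pos two_pos g
    rw [Real.rpow_neg two_pos.le, ← mul_inv, inv_le_inv₀ (by positivity) (by positivity)]
    exact h1
  -- compare `a/q` with `A/2^m`
  have hdiff : |(a : ℝ) / q - A / 2 ^ m| < 1 / (q * 2 ^ m) := by
    have h2m : (0 : ℝ) < 2 ^ m := by positivity
    have e1 : |(a : ℝ) / q - A / 2 ^ m| ≤ Q / 2 ^ n + 2 * Q * ((2 : ℝ) ^ m)⁻¹ * (2 : ℝ) ^ (-g) := by
      have := abs_sub_le ((a : ℝ) / q) (∑ i ∈ S, (r i : ℝ) / 2 ^ i) ((A : ℝ) / 2 ^ m)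
      have h4 : |(a : ℝ) / q - ∑ i ∈ S, (r i : ℝ) / 2 ^ i| ≤ Q / 2 ^ n := by
        rw [abs_sub_comm]; exact hnear
      have h3 : |∑ i ∈ S, (r i : ℝ) / 2 ^ i - A / 2 ^ m| ≤ 2 * Q * ((2 : ℝ) ^ m)⁻¹ * (2 : ℝ) ^ (-g) := by
        rw [hsplit, add_sub_cancel_left]; exact htail
      linarith
    have e2 : Q / 2 ^ n + 2 * Q * ((2 : ℝ) ^ m)⁻¹ * (2 : ℝ) ^ (-g) ≤
        3 * Q * (((2 : ℝ) ^ m)⁻¹ * (2 : ℝ) ^ (-g)) := by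
      have : Q / 2 ^ n ≤ Q * (((2 : ℝ) ^ m)⁻¹ * (2 : ℝ) ^ (-g)) := by
        rw [div_eq_mul_inv]; exact mul_le_mul_of_nonneg_left hm2 hQ0.le
      nlinarith
    have e3 : 3 * Q * (((2 : ℝ) ^ m)⁻¹ * (2 : ℝ) ^ (-g)) < 3 * Q * (((2 : ℝ) ^ m)⁻¹ * (1 / (4 * Q ^ 2))) := by
      gcongr
    have e4 : 3 * Q * (((2 : ℝ) ^ m)⁻¹ * (1 / (4 * Q ^ 2))) ≤ 1 / (q * 2 ^ m) := by
      rw [show 3 * Q * (((2 : ℝ) ^ m)⁻¹ * (1 / (4 * Q ^ 2))) = 3 / (4 * Q) * (1 / 2 ^ m) by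
        field_simp]
      rw [show 1 / ((q : ℝ) * 2 ^ m) = 1 / q * (1 / 2 ^ m) by field_simp]
      refine mul_le_mul_of_nonneg_right ?_ (by positivity)
      rw [div_le_div_iff₀ (by positivity) hq0]
      nlinarith
    linarith
  -- hence `a 2^m = A q` and `q ∣ 2^m`
  have heq : a * 2 ^ m = A * q := by
    have h2m : (0 : ℝ) < 2 ^ m := by positivity
    have h1 : |((a * 2 ^ m - A * q : ℤ) : ℝ)| < 1 := by
      have : ((a * 2 ^ m - A * q : ℤ) : ℝ) = ((a : ℝ) / q - A / 2 ^ m) * (q * 2 ^ m) := by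
        push_cast; field_simp
      rw [this, abs_mul, abs_of_pos (by positivity : (0 : ℝ) < q * 2 ^ m)]
      calc |(a : ℝ) / q - A / 2 ^ m| * (q * 2 ^ m) < 1 / (q * 2 ^ m) * (q * 2 ^ m) :=
            mul_lt_mul_of_pos_right hdiff (by positivity)
        _ = 1 := by field_simp
    have h2 : |a * 2 ^ m - A * q| < 1 := by
      have : ((|a * 2 ^ m - A * q| : ℤ) : ℝ) < 1 := by rw [Int.cast_abs]; exact h1
      exact_mod_cast this
    have h3 : a * 2 ^ m - A * q = 0 := Int.abs_lt_one_iff.1 h2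
    linarith
  have hdvd : (q : ℤ) ∣ 2 ^ m := by
    have h1 : (q : ℤ) ∣ a * 2 ^ m := ⟨A, by rw [heq]; ring⟩
    exact IsCoprime.dvd_of_dvd_mul_left hcop.symm h1
  have hdvd' : q ∣ 2 ^ m := by exact_mod_cast hdvd
  obtain ⟨e, _, he⟩ := (Nat.dvd_prime_pow Nat.prime_two).1 hdvd'
  exact ⟨e, he⟩

end Katai

end Literature.NumberTheory.LFunctions
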